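import Literature.MathematicalPhysics.QuantumFieldTheory.Balaban1983to89.B9Thm310GOfLocalInverse
import Literature.MathematicalPhysics.QuantumFieldTheory.Balaban1983to89.B9Thm310TransposedCommutatorBMajorant

/-!
# `Balaban1983to89.B9Thm310GOfLocalInverseCubes` — T. Bałaban, *Propagators for lattice gauge theories in a background field*, Commun. Math. Phys. **99**
# (1985) 389–434 [Balaban1985BackgroundPropagators], Theorem 3.10 ⇒ Theorem 3.3 (3.42) for `G(U) = Δ_a(U)⁻¹` WITH THE CUBE LETTERS AN ARBITRARY FAMILY `O_□`:
# the cut-off cube Leibniz terms (3.100) and the first family of the TRANSPOSED remainder discharged at generic letters — the (QB1) re-cut of FILES 4a-B ∕ 4b-B ∕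
# 4c-B ∕ CoverCubes ∕ T3 of module M5.7 (cell `lit-balaban`, sub-row G-B9-LETTERS; seat p38 gen 41)

statement-level skeleton of published theorems with citation tags; proofs where landed; nothing here is a claim about the Yang–Mills mass gap

CITATION HEADER (lean-in-tree rule).  B9 = T. Bałaban, *Propagators for lattice gauge theories in a background field*, Commun. Math. Phys. **99** (1985)
389–434 (PDF held: `paper:balaban1985-cmp99-background-propagators`, journal page = PDF page + 388).  p. 413 (3.100) «(D_μ hA_ν)(x) = h(x)(D_μA_ν)(x) +
(∂_μh)(x)R(U(x, x+ηe_μ))A_ν(x+ηe_μ)» with «similarly for adjoint derivatives»; p. 414 (3.104) «Δ_a hA = hΔ_a − K(h)A − P₁(∂h)A», (3.105) «Δ_aG₀ = I − Σ_□K(h_□)G_□h_□ −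
Σ_□(1 − ζ_□̃)DPD*h_□G_□h_□ − Σ_□ζ_□̃(DPD* − DP_□D*)h_□G_□h_□ − Σ_□ζ_□̃P_{□,1}(∂h_□)G_□h_□ = I − R», p. 414 l. 33–35 «The operator K(h_□)G_□h_□ satisfies the
inequality (3.89), hence it is small»; p. 415 l. 6 «We use again the flexibility of these expansions»; p. 416 «Theorem 3.10 implies Theorem 3.3»; p. 399
Theorem 3.3 with (3.42) p. 397; (3.87) p. 409 «G₀ = Σ_{□∈𝒟} h_□G_□h_□»; p. 409 l. 3–5 «The operators constructed for this sequence, which we denote by G′_□(U),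
C_□(U) = (Q(U)G′_□²(U)Q*(U))⁻¹, G_□(U), satisfy all the inequalities of Theorems 3.1–3.3 correspondingly»; p. 410 l. 2–3 «This theorem follows simply from Corollary
3.6 holding for all G′_□, □ ∈ 𝒟, from the bound (3.89) and Lemma 2.1.»; (3.89) p. 409 «|(K(h_□)G′_□h_□λ)(x)| ≦ O(M⁻¹)e^{−δ₀(Lʲη)⁻¹|y−y′|}|λ|» (x ∈ Δ(y), supp λ ⊂
Δ(y′), y, y′ ∈ □ ∈ 𝒟_j) — the cell's composite constants below (`θ_Tᴮ`, `A₁`, `A₂`, `A₃`) are our reading of (3.89) ∕ (3.42) with explicit constants, not print's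
display.  [4] = [Balaban1984PropagatorsII] (2.51)–(2.52) p. 232 («A summation preserves it also»), Prop. 2.2 (2.65)–(2.67) p. 234, Lemma 2.1 (2.61) p. 234, p. 235.
Rows B9.Thm3.10 × B9.Thm3.3 × B9.Eq3.100 × B9.Eq3.105 (cells only; no row head changes).

WHY THIS FILE (the (QB1) re-cut, second half; cell HOME∕INBOX 2026-08-28 11:46:58Z «(QB1) ANSWER: YES … OWNER: p38 lineage (6-B author)»).  `B9Thm310GOfLocalInverse`
re-ran FILES 1-B ∕ 2-B ∕ 3-B ∕ 6-B at an ARBITRARY per-cube bond-letter family `Oc` with the local-inverse laws up to displayed defects; its consumer-facing block still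
displays the cube Leibniz majorants `hTE`∕`hTF`∕`hTL` and the whole transposed remainder `hV`.  THIS FILE discharges them at generic letters exactly as FILES 4a-B ∕
4b-B ∕ 4c-B (`B9Thm310CutoffGradTermsB` ∕ `…DivTermsB` ∕ `…LapTermsB`) and T3 (`B9Thm310TransposedCommutatorBMajorant`) did at r05's `GACubeY`: every ENGINE there
is already letter-generic (`norm_cdB_hOh_le`, `norm_hOh_cdsB_le`, `norm_lapB_hOh_le`, the localisation lemmas `exists_nearQT_of_*`, T2's `norm_hTY_O_KhBY_apply_le`,
T3's input-locality `KhBY_apply_eq_zero_of_input` ∕ `exists_input_of_KhBY_ne_zero`, the sums `sum_*_majorant_le`, `sum_transposedCommB_majorant_le`) and is reused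
BY NAME; only the `GACubeY`-pinned per-cube wrappers and the two assemblies are twinned, with the letters' (3.42) blocks `hE` at `U₁` the only per-cube input.

WHAT IS PROVED (all `theorem`s, 0 `def`, 0 sorry, 0 new named facts).
* §1 ★ `hasMajorant_conj_gradTermB_Oc`, ★ `hasMajorant_conj_divTermB_Oc`, ★ `hasMajorant_conj_lapTermB_Oc` — the `hTE ν □` ∕ `hTF ν □` ∕ `hTL □` inputs at a generic
  letter `O_□` from its (3.42) block over the class (4a-B ∕ 4b-B ∕ 4c-B re-run): localized block majorants of `conj b(∇_{U,ν})·(h_□·conj b O_□·h_□)`,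
  `(h_□·conj b O_□·h_□)·conj b(∇*_{U,ν})`, `conj b(Δ_U)·(h_□·conj b O_□·h_□)`.
* §2 ★★★ `eBlock_kernelFamilyBInv_GAY_of_localInverseCubes` — `B9Thm310GOfLocalInverse.eBlock_kernelFamilyBInv_GAY_of_localInverse` with §1 plugged in (CoverCubes
  re-run): displayed `hE`, `hdef`∕`hdefT`, `hrest` (families 2–4 + defect family), `hV` (transposed families 1–4 + defect family), `hinvU`, bi-contractivity, plaquette
  datum, (2.61)∕(2.63), the two smallness conditions.
* §3 ★★ `hasMajorant_conj_transposedCommB_Oc`, ★★ `hasMajorant_sum_conj_transposedCommB_Oc` — the transposed family 1 `−Σ_□ h_□O_□K(h_□)` at generic letters (T3 §4–§5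
  re-run): scale-weighted majorant `N′·M₂(Σ‖b_j‖)·θ_Tᴮ·L⁵·ℓ(a)ℓ(a′)⁻¹e^{−δ₀d}`.
* §4 ★★★ `eBlock_kernelFamilyBInv_GAY_of_localInverseCubes'` — THE ENDPOINT OF THE (QB1) RE-CUT: T3's `eBlock_kernelFamilyBInv_GAY_of_coverCubes'` with
  `GACubeY ↦ Oc`, `DP_□D* ↦ Pl`, `P_{□,1} ↦ P1l`, `hinvC ↦ (hdef, hdefT)`; displayed `hV′` = transposed families 2–4 + the defect family `Σ_□ conj b E♯_□`, `θ_V = θ₁ + θ′_V`.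
* §5 ★★★ `eBlock_kernelFamilyBInv_GAY_of_localInverseCubes'_exact` — the EXACT-LAW form (`hloc`∕`hlocT`, no defect families; the literal bond twin of p21's
  `eBlock_kernelFamilySInv_Gp_of_localInverse`).  CONSISTENCY (kernel-checked in the seat's scratch, not filed — it restates a landed declaration): T3's endpoint
  `eBlock_kernelFamilyBInv_GAY_of_coverCubes'` follows VERBATIM from `…'_exact` at `Oc := GACubeY`, `Pl := DP_□D*(U₁)`, `P1l := P_{□,1}(∂h_□)(U₁)`, the exact laws supplied
  by `hinvC` + r05's NearH agreement (`B9Eq3105AtLetters.hloc_GACubeY`, `B9Eq3105TAtLetters.hlocT_GACubeY`).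

HONEST SCOPE.  As the parents: DISPLAYED `hE` (Cor. 3.6 ∕ Thm 3.3 blocks of every cube letter `O_□` at `U₁` — the M5.1b-G hand's output), `hdef`∕`hdefT` (algebra of
the letter; exact for print's letters and r05's `GACubeY`, `B9Eq3105OfLocalInverse.hdef_GACubeY`), `hrest` and `hV′` (families 2–4: p. 415's walk re-expansion of
`P`, (3.101) — cell GAPS G-B9-05∕06a∕07 — plus the defect families, an (R)-DESIGN TERM NOT IN PRINT), `hinvU` (M5.3 lineage), bi-contractivity (unitary fibre), the
plaquette datum `hW` (print's (3.35) via `…DataOfPlaquettes.plaquetteDefect_of_reg335P`), `η = |c_f|⁻¹`, `0 ≤ b₁`, [4] Lemma 2.1, the two smallness conditions.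
Sup-entries (3.42) only.  Nothing continuum ∕ OS ∕ mass gap ∕ Clay; YM mass gap NOT proved by any of this (Track A conditional rung).  `--supports stmt-QuantumFields-19200`.
RELATED, NOT DUPLICATED (searched 2026-08-28: `lean search 'localInverseCubes|TermB_Oc|transposedCommB_Oc' --decl` = ∅): FILES 4a-B ∕ 4b-B ∕ 4c-B ∕ CoverCubes ∕ T3
stay for the `GACubeY` instance.
-/

noncomputable section

namespace Literature.MathematicalPhysics.QuantumFieldTheory.Balaban1983to89.B9Thm310GOfLocalInverseCubes

open Node00 B9CubeLettersInvReadings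
open B9Thm310TransposedCommutatorB (norm_hTY_O_KhBY_apply_le card_ball_le_of_ineq261 avg_apply_eq_zero_of)
open B9Thm310TransposedCommutatorBMajorant (KhBY_apply_eq_zero_of_input exists_input_of_KhBY_ne_zero one_le_pow_mul_len_ratio sum_transposedCommB_majorant_le)
open B9Thm37CubeCoverCommutators (cutMulY cutMulY_apply hTY)
open B9Thm37CubeCoverCommutatorSizes (side_conditions four_le_P' abs_hTY_shiftY_sub_le abs_hTY_shiftY_symm_sub_le)
open B9Thm37CommutatorBound389 (norm_cutMulY_le_of_le lev_le_succ_of_touch lev_le_succ_of_touch' torusSupNorm_sub_shiftY_le_one dist_blkOf_le_one_of_touch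
  geo9K_len_eq levY_eq_lvl_of_blkOf_eq)
open B9Thm37TransposedCommutator (lvl_ge_of_mem_QT)
open B9Eq3104CutoffCommutators
open B9Eq3104CommutatorSupport (trLiftY_apply_eq_zero_of jordanY_apply_eq_zero_of touch_symm touch_of_gradK_ne_zero touch_src_of_curlK_ne_zero
  touch_plaq_of_curlK_ne_zero touch_src_edgeY qwt_ne_zero_of_qsK_ne_zero qwt_ne_zero_of_qK_ne_zero levY_src_bounds_of_qwt_ne_zero
  levY_src_le_of_KhBY_hTY_ne_zero)
open B9Eq3104CommutatorSizesLoc (norm_cutCommR_curv2Y_hTY_apply_le_loc)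
open B9Thm310CommutatorBound389B (abs_le_supNorm_inr step_facts two_step_facts b1_pos theta389B)
open B9Thm310CommutatorBound389BMajorant (hasMajorant_conj_of_ball_boundB norm_liftY_le_abs)
open B9CubeLettersInvReadDictB (h342₀_of_eBlockInvB h342₁_of_eBlockInvB h342₂_of_eBlockInvB h342₃_of_eBlockInvB)
open B9Thm310CommutatorDataOfPlaquettes (bicontr_holY)
open B9Thm310CommutatorSum (sum_indicator_nearQT_le)
open B9Thm310CutoffGradTermsB (norm_cdB_hOh_le exists_nearQT_of_cdB_hOh_ne_zero sum_gradTermB_majorant_le)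
open B9Thm310CutoffDivTermsB (norm_hOh_cdsB_le sum_divTermB_majorant_le card_near_le_of_ineq261 sum_indicator_const_le)
open B9Thm310CutoffLapTermsB (norm_lapB_hOh_le exists_nearQT_of_lapB_hOh_ne_zero sum_lapTermB_majorant_le)
open B9Thm310GOfLocalInverse (eBlock_kernelFamilyBInv_GAY_of_localInverse)
open B9Thm39CinvTorusRegular (conj_cutMulY)
open B9Thm37Sum (mulOp hasMajorant_finsetSum)
open Node00.OpsYBondLift (cdBC cdBC_apply cdsBC cdsBC_apply lapBC lapBC_apply)
open B6KLevelCensusIndexV1 (KIdx)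
open B6Ineq2142KLevelV1 (β lvl beta_level)
open B6GlobalChartV1 (blkV1)
open B4TorusKernel.MultiPeriod (torusSupNorm)
open B6Geom246MultiLevelBox (bset blkOf)
open B6Geom246MultiLevelTorus (bondT)
open B6Cover236MultiLevelBlocks (cubes)
open B6Partition118KLevelTorusCentral (QT blkOf_mem_QT_of_hT_ne_zero)
open B6Partition118KLevelFineSizes (C1F C1F_nonneg)
open B6Partition118KLevelFineSecond (C2F C2F_nonneg)
open B6Partition118KLevelFineMixed (C2X C2X_bounds)
open B6Partition118KLevelTorusBinders (sLipT sLipT_nonneg)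
open B6RandomWalk (HasMajorant Ineq261 Ineq263 hasMajorant_mono hasMajorant_add c1_nonneg)
open B9Thm34Ext (toB6)
open B9FromB6 (EBlock)
open B9GeoNormsKLevelV1 (geo9K geo9K_supNorm_nonneg)
open B9Eq352DivFormLetters (conj)
open B9Ineq349SiteComposite (etaS_pos)
open Node00.OpsYNablaBridge (chartY divK_apply)
open scoped Matrix

variable {d ℓ : ℕ} {hd : 1 ≤ d + 1} {hL : Odd (ℓ + 1) ∧ 1 < ℓ + 1} {b₀ b₁ : ℝ}
variable {𝔸 : Type} [NormedRing 𝔸] [NormedAlgebra ℂ 𝔸] [CompleteSpace 𝔸]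
variable {ι : Type} [Fintype ι] [DecidableEq ι]
variable (i : KIdx d ℓ hd hL b₀ b₁) (b : Module.Basis ι ℝ 𝔸)
variable [Fintype (geo9K i).Site] [DecidableEq (geo9K i).Site] {Rr : ℝ} {Hp : Prop}
variable (ιB : BlkY i → IBondY i)
variable {B : B9.Backgrounds} (cfg : B.Cfg → CfgY 𝔸 i) (par : BondParY 𝔸 i) {U₁ : B.Cfg}

/-! ## §1 The cut-off cube Leibniz terms at a generic cube letter, from its (3.42) block over the class (4a-B ∕ 4b-B ∕ 4c-B re-run) -/

section Leibniz

omit [DecidableEq ι] [DecidableEq (geo9K i).Site] in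
/-- ★ **THE `hTE ν □` INPUT AT A GENERIC CUBE LETTER `O_□`, FROM ITS (3.42) BLOCK OVER THE CLASS**: for any ℝ-linear `D` agreeing pointwise with `∇_{U,ν}` at
`U = cfg U₁`, `conj b(D)·(h_□·conj b O_□(U)·h_□)` has the localized block majorant `1_{S′_□}(a)·M₂(Σ‖b_j‖)·B₀(1 + 5C1F·L·e^{δ}∕(8M_h))·ℓ(a)·e^{−δd(a,a′)}`
(4a-B `hasMajorant_conj_gradTermB` re-run; engine `norm_cdB_hOh_le`, letter-generic). [cite: Balaban1985BackgroundPropagators, (3.100) p.413, Thm 3.3 (3.42) pp.397–399, (3.87) p.409; Balaban1984PropagatorsII, (2.51)–(2.52) p.232] -/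
theorem hasMajorant_conj_gradTermB_Oc (hι : ∀ s, β i.hN i.D i.hk (ιB s) = s)
    {M₂ : ℝ} (hM₂ : 0 ≤ M₂) (hrepr : ∀ (v : 𝔸) (j : ι), |b.repr v j| ≤ M₂ * ‖v‖) (hη : etaS i = |i.cf|⁻¹)
    (Oc : ↥(cubes i.D.toDomains) → BondOpY 𝔸 i) {B₀ δ : ℝ} (hB₀ : 0 ≤ B₀) (hδ : 0 ≤ δ)
    (c : ↥(cubes i.D.toDomains)) (hE : EBlock (kernelFamilyBInv i B cfg (Oc c) par) B₀ δ U₁)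
    (hU : ∀ μ x, ‖(cfg U₁ μ x : 𝔸)‖ ≤ 1 ∧ ‖(((cfg U₁ μ x)⁻¹ : 𝔸ˣ) : 𝔸)‖ ≤ 1)
    (μ : Fin (d + 1)) (D : Module.End ℝ (FBondY i → 𝔸)) (hD : ∀ Λ, D Λ = cdB i (cfg U₁) μ Λ) :
    HasMajorant (g := toB6 (geo9K i) Rr Hp) (fun p : FBondY i × ι => ιB (blkV1 i.hN i.D p.1))
      (conj b D * (mulOp (fun p : FBondY i × ι => hBdY i (hTY i c) p.1) * conj b ((Oc c (cfg U₁)).restrictScalars ℝ) *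
        mulOp (fun p : FBondY i × ι => hBdY i (hTY i c) p.1)))
      (fun a a' => if (∃ y ∈ QT i.D (B9GeoLemma21KLevelV1.one_le_Mh i) (four_le_P' i) c,
          (((bondT i.D).dist (β i.hN i.D i.hk a) y : ℕ) : ℝ) ≤ 2 * (ℓ : ℝ) + 6)
        then M₂ * (∑ j, ‖b j‖) * (B₀ * (1 + 5 * C1F d ℓ * (((ℓ : ℝ) + 1) * Real.exp δ) / (8 * (i.Mh : ℝ)))) * (geo9K i).len a
          * Real.exp (-(δ * (geo9K i).dist a a')) else 0) := by
  classical
  -- the operator as ONE conjugated ℝ-linear letter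
  set Rl : Module.End ℝ (FBondY i → 𝔸) := D * ((cutMulY (𝔸 := 𝔸) (hBdY i (hTY i c))).restrictScalars ℝ *
    (Oc c (cfg U₁)).restrictScalars ℝ * (cutMulY (𝔸 := 𝔸) (hBdY i (hTY i c))).restrictScalars ℝ) with hRl
  have hRl_apply : ∀ Λ, Rl Λ = cdB i (cfg U₁) μ (cutMulY (hBdY i (hTY i c)) (Oc c (cfg U₁) (cutMulY (hBdY i (hTY i c)) Λ))) :=
    fun Λ => by simp only [hRl, Module.End.mul_apply, LinearMap.restrictScalars_apply, hD]
  have hconj : conj b Rl = conj b D * (mulOp (fun p : FBondY i × ι => hBdY i (hTY i c) p.1) *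
      conj b ((Oc c (cfg U₁)).restrictScalars ℝ) * mulOp (fun p : FBondY i × ι => hBdY i (hTY i c) p.1)) := by
    rw [hRl, B9Eq352DivFormLetters.conj_mul, B9Eq352DivFormLetters.conj_mul, B9Eq352DivFormLetters.conj_mul, conj_cutMulY]
  rw [← hconj]
  have hT : ∀ (cx : ℂ) (Λ : FBondY i → 𝔸), Rl (cx • Λ) = cx • Rl Λ := fun cx Λ => by
    rw [hRl_apply, hRl_apply, map_smul, map_smul, map_smul, ← cdBC_apply, ← cdBC_apply, map_smul]
  have hC1F : 0 ≤ C1F d ℓ := C1F_nonneg d ℓ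
  have hA₀ : 0 ≤ B₀ * (1 + 5 * C1F d ℓ * (((ℓ : ℝ) + 1) * Real.exp δ) / (8 * (i.Mh : ℝ))) := mul_nonneg hB₀ (by positivity)
  have hW0 : ∀ a a' : IBondY i, 0 ≤ (if (∃ y ∈ QT i.D (B9GeoLemma21KLevelV1.one_le_Mh i) (four_le_P' i) c,
        (((bondT i.D).dist (β i.hN i.D i.hk a) y : ℕ) : ℝ) ≤ 2 * (ℓ : ℝ) + 6)
      then (B₀ * (1 + 5 * C1F d ℓ * (((ℓ : ℝ) + 1) * Real.exp δ) / (8 * (i.Mh : ℝ)))) * (geo9K i).len a * Real.exp (-(δ * (geo9K i).dist a a'))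
      else 0) := fun a a' =>
    ite_nonneg (mul_nonneg (mul_nonneg hA₀ (B9GeoLemma21KLevelV1.geo9K_len_pos i a).le) (Real.exp_nonneg _)) le_rfl
  refine hasMajorant_mono (g := toB6 (geo9K i) Rr Hp) _
    (hasMajorant_conj_of_ball_boundB i b (Rr := Rr) (Hp := Hp) Rl hT ιB hι hM₂ hrepr _ hW0 fun J y y' hs E hE1 x hx => ?_)
    fun a a' => le_of_eq ?_
  · -- the ball bound at `x ∈ Δ(βy)`, split on the localisation set
    rw [hRl_apply]
    by_cases hmem : ∃ yq ∈ QT i.D (B9GeoLemma21KLevelV1.one_le_Mh i) (four_le_P' i) c,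
        (((bondT i.D).dist (β i.hN i.D i.hk y) yq : ℕ) : ℝ) ≤ 2 * (ℓ : ℝ) + 6
    · rw [if_pos hmem]
      exact norm_cdB_hOh_le i (cfg U₁) (Oc c (cfg U₁)) c hB₀ hδ hη ιB hι hU
        (h342₀_of_eBlockInvB i b cfg (Oc c) par hE hM₂ hrepr)
        (h342₁_of_eBlockInvB i b cfg (Oc c) par hE hM₂ hrepr) J y y' hs (liftY J E) (norm_liftY_le_abs i J hE1) μ x hx
    · rw [if_neg hmem, zero_mul]
      refine le_of_eq (norm_eq_zero.2 ?_)
      by_contra hne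
      obtain ⟨yq, hyq, hdq⟩ := exists_nearQT_of_cdB_hOh_ne_zero i (cfg U₁) c _ μ x hne
      rw [hx] at hdq
      exact hmem ⟨yq, hyq, hdq⟩
  · by_cases h : ∃ yq ∈ QT i.D (B9GeoLemma21KLevelV1.one_le_Mh i) (four_le_P' i) c,
        (((bondT i.D).dist (β i.hN i.D i.hk a) yq : ℕ) : ℝ) ≤ 2 * (ℓ : ℝ) + 6
    · rw [if_pos h, if_pos h]; ring
    · rw [if_neg h, if_neg h, mul_zero]

omit [DecidableEq ι] [DecidableEq (geo9K i).Site] in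
/-- ★ **THE `hTF ν □` INPUT AT A GENERIC CUBE LETTER `O_□`**: for any ℝ-linear `D*` agreeing pointwise with `∇*_{U,ν}` at `U = cfg U₁` and at most `m_N` index bonds
within `1` of a bond, `(h_□·conj b O_□(U)·h_□)·conj b(D*)` has the localized block majorant `1_{S′_□}(a)·M₂(Σ‖b_j‖)·B₀(1 + m_N e^{δ}(5∕8)C1F∕M_h)·ℓ(a)·e^{−δd(a,a′)}`
(4b-B `hasMajorant_conj_divTermB` re-run; engine `norm_hOh_cdsB_le`, letter-generic; print: «similarly for adjoint derivatives»).
[cite: Balaban1985BackgroundPropagators, (3.100) p.413, Thm 3.3 (3.42) pp.397–399, (3.87) p.409; Balaban1984PropagatorsII, (2.51)–(2.52) p.232, Lemma 2.1 (2.61) p.234] -/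
theorem hasMajorant_conj_divTermB_Oc (hι : ∀ s, β i.hN i.D i.hk (ιB s) = s)
    {M₂ : ℝ} (hM₂ : 0 ≤ M₂) (hrepr : ∀ (v : 𝔸) (j : ι), |b.repr v j| ≤ M₂ * ‖v‖) (hη : etaS i = |i.cf|⁻¹)
    (Oc : ↥(cubes i.D.toDomains) → BondOpY 𝔸 i) {B₀ δ : ℝ} (hB₀ : 0 ≤ B₀) (hδ : 0 ≤ δ)
    (c : ↥(cubes i.D.toDomains)) (hE : EBlock (kernelFamilyBInv i B cfg (Oc c) par) B₀ δ U₁)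
    (hU : ∀ μ x, ‖(cfg U₁ μ x : 𝔸)‖ ≤ 1 ∧ ‖(((cfg U₁ μ x)⁻¹ : 𝔸ˣ) : 𝔸)‖ ≤ 1)
    (T : IBondY i → Finset (IBondY i)) (hT : ∀ a y' : IBondY i, (geo9K i).dist a y' ≤ 1 → a ∈ T y')
    {mN : ℝ} (hmN : 0 ≤ mN) (hnbr : ∀ y' : IBondY i, ((T y').card : ℝ) ≤ mN)
    (μ : Fin (d + 1)) (Ds : Module.End ℝ (FBondY i → 𝔸)) (hDs : ∀ Λ, Ds Λ = cdsB i (cfg U₁) μ Λ) :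
    HasMajorant (g := toB6 (geo9K i) Rr Hp) (fun p : FBondY i × ι => ιB (blkV1 i.hN i.D p.1))
      ((mulOp (fun p : FBondY i × ι => hBdY i (hTY i c) p.1) * conj b ((Oc c (cfg U₁)).restrictScalars ℝ) *
        mulOp (fun p : FBondY i × ι => hBdY i (hTY i c) p.1)) * conj b Ds)
      (fun a a' => if (∃ y ∈ QT i.D (B9GeoLemma21KLevelV1.one_le_Mh i) (four_le_P' i) c,
          (((bondT i.D).dist (β i.hN i.D i.hk a) y : ℕ) : ℝ) ≤ 2 * (ℓ : ℝ) + 6)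
        then M₂ * (∑ j, ‖b j‖) * (B₀ * (1 + mN * Real.exp δ * (5 / 8 * C1F d ℓ / i.Mh))) * (geo9K i).len a
          * Real.exp (-(δ * (geo9K i).dist a a')) else 0) := by
  classical
  obtain ⟨_, hMh2, hR2, _⟩ := side_conditions i
  -- the operator as ONE conjugated ℝ-linear letter
  set Rl : Module.End ℝ (FBondY i → 𝔸) := ((cutMulY (𝔸 := 𝔸) (hBdY i (hTY i c))).restrictScalars ℝ *
    (Oc c (cfg U₁)).restrictScalars ℝ * (cutMulY (𝔸 := 𝔸) (hBdY i (hTY i c))).restrictScalars ℝ) * Ds with hRl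
  have hRl_apply : ∀ Λ, Rl Λ = cutMulY (hBdY i (hTY i c)) (Oc c (cfg U₁) (cutMulY (hBdY i (hTY i c)) (cdsB i (cfg U₁) μ Λ))) :=
    fun Λ => by simp only [hRl, Module.End.mul_apply, LinearMap.restrictScalars_apply, hDs]
  have hconj : conj b Rl = (mulOp (fun p : FBondY i × ι => hBdY i (hTY i c) p.1) *
      conj b ((Oc c (cfg U₁)).restrictScalars ℝ) * mulOp (fun p : FBondY i × ι => hBdY i (hTY i c) p.1)) * conj b Ds := by
    rw [hRl, B9Eq352DivFormLetters.conj_mul, B9Eq352DivFormLetters.conj_mul, B9Eq352DivFormLetters.conj_mul, conj_cutMulY]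
  rw [← hconj]
  have hTc : ∀ (cx : ℂ) (Λ : FBondY i → 𝔸), Rl (cx • Λ) = cx • Rl Λ := fun cx Λ => by
    rw [hRl_apply, hRl_apply, ← cdsBC_apply, ← cdsBC_apply, map_smul, map_smul, map_smul, map_smul]
  have hC1F : 0 ≤ C1F d ℓ := C1F_nonneg d ℓ
  have hA₀ : 0 ≤ B₀ * (1 + mN * Real.exp δ * (5 / 8 * C1F d ℓ / i.Mh)) := mul_nonneg hB₀ (by positivity)
  have hW0 : ∀ a a' : IBondY i, 0 ≤ (if (∃ y ∈ QT i.D (B9GeoLemma21KLevelV1.one_le_Mh i) (four_le_P' i) c,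
        (((bondT i.D).dist (β i.hN i.D i.hk a) y : ℕ) : ℝ) ≤ 2 * (ℓ : ℝ) + 6)
      then (B₀ * (1 + mN * Real.exp δ * (5 / 8 * C1F d ℓ / i.Mh))) * (geo9K i).len a * Real.exp (-(δ * (geo9K i).dist a a'))
      else 0) := fun a a' =>
    ite_nonneg (mul_nonneg (mul_nonneg hA₀ (B9GeoLemma21KLevelV1.geo9K_len_pos i a).le) (Real.exp_nonneg _)) le_rfl
  refine hasMajorant_mono (g := toB6 (geo9K i) Rr Hp) _
    (hasMajorant_conj_of_ball_boundB i b (Rr := Rr) (Hp := Hp) Rl hTc ιB hι hM₂ hrepr _ hW0 fun J y y' hs E hE1 x hx => ?_)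
    fun a a' => le_of_eq ?_
  · rw [hRl_apply]
    by_cases hmem : ∃ yq ∈ QT i.D (B9GeoLemma21KLevelV1.one_le_Mh i) (four_le_P' i) c,
        (((bondT i.D).dist (β i.hN i.D i.hk y) yq : ℕ) : ℝ) ≤ 2 * (ℓ : ℝ) + 6
    · rw [if_pos hmem]
      exact norm_hOh_cdsB_le i (cfg U₁) (Oc c (cfg U₁)) c hB₀ hδ hη ιB hι hU
        (h342₀_of_eBlockInvB i b cfg (Oc c) par hE hM₂ hrepr)
        (h342₂_of_eBlockInvB i b cfg (Oc c) par hE hM₂ hrepr) T hT hmN hnbr J y y' hs (liftY J E) (norm_liftY_le_abs i J hE1) x μ hx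
    · -- the outer cut-off vanishes: `h_□(b₋) ≠ 0` would put `Δ(b) = βy` in `QT □`
      rw [if_neg hmem, zero_mul]
      refine le_of_eq (norm_eq_zero.2 ?_)
      rw [cutMulY_apply, hBdY_apply]
      by_cases h0 : hTY i c (chartY i x.src) = 0
      · rw [h0, Complex.ofReal_zero, zero_smul]
      · exfalso
        refine hmem ⟨blkOf i.D.toDomains (chartY i x.src), blkOf_mem_QT_of_hT_ne_zero hMh2 hR2 (four_le_P' i) c h0, ?_⟩
        rw [← hx]
        have e : (bondT i.D).dist (blkV1 i.hN i.D x) (blkOf i.D.toDomains (chartY i x.src)) = 0 := SimpleGraph.dist_self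
        rw [e, Nat.cast_zero]; positivity
  · by_cases h : ∃ yq ∈ QT i.D (B9GeoLemma21KLevelV1.one_le_Mh i) (four_le_P' i) c,
        (((bondT i.D).dist (β i.hN i.D i.hk a) yq : ℕ) : ℝ) ≤ 2 * (ℓ : ℝ) + 6
    · rw [if_pos h, if_pos h]; ring
    · rw [if_neg h, if_neg h, mul_zero]

omit [DecidableEq ι] [DecidableEq (geo9K i).Site] in
/-- ★ **THE `hTL □` INPUT AT A GENERIC CUBE LETTER `O_□`**: for any ℝ-linear `L` agreeing pointwise with `Δ_U` at `U = cfg U₁`, `conj b(L)·(h_□·conj b O_□(U)·h_□)` has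
the localized block majorant `1_{S′_□}(a)·M₂(Σ‖b_j‖)·B₀(1 + (d+1)((5∕8)(C1F∕M_h)(e^{δ}+1) + (25∕64)C2F∕M_h²))·e^{−δd(a,a′)}` (4c-B `hasMajorant_conj_lapTermB` re-run;
engine `norm_lapB_hOh_le`, letter-generic). [cite: Balaban1985BackgroundPropagators, (3.100) p.413, (3.104) p.414, Thm 3.3 (3.42) pp.397–399, (3.87) p.409; Balaban1984PropagatorsII, (2.51)–(2.52) p.232] -/
theorem hasMajorant_conj_lapTermB_Oc (hι : ∀ s, β i.hN i.D i.hk (ιB s) = s)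
    {M₂ : ℝ} (hM₂ : 0 ≤ M₂) (hrepr : ∀ (v : 𝔸) (j : ι), |b.repr v j| ≤ M₂ * ‖v‖) (hη : etaS i = |i.cf|⁻¹)
    (Oc : ↥(cubes i.D.toDomains) → BondOpY 𝔸 i) {B₀ δ : ℝ} (hB₀ : 0 ≤ B₀) (hδ : 0 ≤ δ)
    (c : ↥(cubes i.D.toDomains)) (hE : EBlock (kernelFamilyBInv i B cfg (Oc c) par) B₀ δ U₁)
    (hU : ∀ μ x, ‖(cfg U₁ μ x : 𝔸)‖ ≤ 1 ∧ ‖(((cfg U₁ μ x)⁻¹ : 𝔸ˣ) : 𝔸)‖ ≤ 1)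
    (Lp : Module.End ℝ (FBondY i → 𝔸)) (hLp : ∀ Λ, Lp Λ = lapB i (cfg U₁) Λ) :
    HasMajorant (g := toB6 (geo9K i) Rr Hp) (fun p : FBondY i × ι => ιB (blkV1 i.hN i.D p.1))
      (conj b Lp * (mulOp (fun p : FBondY i × ι => hBdY i (hTY i c) p.1) * conj b ((Oc c (cfg U₁)).restrictScalars ℝ) *
        mulOp (fun p : FBondY i × ι => hBdY i (hTY i c) p.1)))
      (fun a a' => if (∃ y ∈ QT i.D (B9GeoLemma21KLevelV1.one_le_Mh i) (four_le_P' i) c,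
          (((bondT i.D).dist (β i.hN i.D i.hk a) y : ℕ) : ℝ) ≤ 2 * (ℓ : ℝ) + 6)
        then M₂ * (∑ j, ‖b j‖) * (B₀ * (1 + ((d : ℝ) + 1) * (5 / 8 * C1F d ℓ / i.Mh * (Real.exp δ + 1) + 25 / 64 * C2F d ℓ / i.Mh ^ 2)))
          * Real.exp (-(δ * (geo9K i).dist a a')) else 0) := by
  classical
  -- the operator as ONE conjugated ℝ-linear letter
  set Rl : Module.End ℝ (FBondY i → 𝔸) := Lp * ((cutMulY (𝔸 := 𝔸) (hBdY i (hTY i c))).restrictScalars ℝ *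
    (Oc c (cfg U₁)).restrictScalars ℝ * (cutMulY (𝔸 := 𝔸) (hBdY i (hTY i c))).restrictScalars ℝ) with hRl
  have hRl_apply : ∀ Λ, Rl Λ = lapB i (cfg U₁) (cutMulY (hBdY i (hTY i c)) (Oc c (cfg U₁) (cutMulY (hBdY i (hTY i c)) Λ))) :=
    fun Λ => by simp only [hRl, Module.End.mul_apply, LinearMap.restrictScalars_apply, hLp]
  have hconj : conj b Rl = conj b Lp * (mulOp (fun p : FBondY i × ι => hBdY i (hTY i c) p.1) *
      conj b ((Oc c (cfg U₁)).restrictScalars ℝ) * mulOp (fun p : FBondY i × ι => hBdY i (hTY i c) p.1)) := by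
    rw [hRl, B9Eq352DivFormLetters.conj_mul, B9Eq352DivFormLetters.conj_mul, B9Eq352DivFormLetters.conj_mul, conj_cutMulY]
  rw [← hconj]
  have hT : ∀ (cx : ℂ) (Λ : FBondY i → 𝔸), Rl (cx • Λ) = cx • Rl Λ := fun cx Λ => by
    rw [hRl_apply, hRl_apply, map_smul, map_smul, map_smul, ← lapBC_apply, ← lapBC_apply, map_smul]
  have hC1F : 0 ≤ C1F d ℓ := C1F_nonneg d ℓ
  have hC2F : 0 ≤ C2F d ℓ := C2F_nonneg d ℓ
  have hA₀ : 0 ≤ B₀ * (1 + ((d : ℝ) + 1) * (5 / 8 * C1F d ℓ / i.Mh * (Real.exp δ + 1) + 25 / 64 * C2F d ℓ / i.Mh ^ 2)) := mul_nonneg hB₀ (by positivity)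
  have hW0 : ∀ a a' : IBondY i, 0 ≤ (if (∃ y ∈ QT i.D (B9GeoLemma21KLevelV1.one_le_Mh i) (four_le_P' i) c,
        (((bondT i.D).dist (β i.hN i.D i.hk a) y : ℕ) : ℝ) ≤ 2 * (ℓ : ℝ) + 6)
      then (B₀ * (1 + ((d : ℝ) + 1) * (5 / 8 * C1F d ℓ / i.Mh * (Real.exp δ + 1) + 25 / 64 * C2F d ℓ / i.Mh ^ 2))) * Real.exp (-(δ * (geo9K i).dist a a'))
      else 0) := fun a a' => ite_nonneg (mul_nonneg hA₀ (Real.exp_nonneg _)) le_rfl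
  refine hasMajorant_mono (g := toB6 (geo9K i) Rr Hp) _
    (hasMajorant_conj_of_ball_boundB i b (Rr := Rr) (Hp := Hp) Rl hT ιB hι hM₂ hrepr _ hW0 fun J y y' hs E hE1 x hx => ?_)
    fun a a' => le_of_eq ?_
  · rw [hRl_apply]
    by_cases hmem : ∃ yq ∈ QT i.D (B9GeoLemma21KLevelV1.one_le_Mh i) (four_le_P' i) c,
        (((bondT i.D).dist (β i.hN i.D i.hk y) yq : ℕ) : ℝ) ≤ 2 * (ℓ : ℝ) + 6
    · rw [if_pos hmem]
      exact norm_lapB_hOh_le i (cfg U₁) (Oc c (cfg U₁)) c hB₀ hδ hη ιB hι hU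
        (h342₀_of_eBlockInvB i b cfg (Oc c) par hE hM₂ hrepr)
        (h342₁_of_eBlockInvB i b cfg (Oc c) par hE hM₂ hrepr)
        (h342₃_of_eBlockInvB i b cfg (Oc c) par hE hM₂ hrepr) J y y' hs (liftY J E) (norm_liftY_le_abs i J hE1) x hx
    · rw [if_neg hmem, zero_mul]
      refine le_of_eq (norm_eq_zero.2 ?_)
      by_contra hne
      obtain ⟨yq, hyq, hdq⟩ := exists_nearQT_of_lapB_hOh_ne_zero i (cfg U₁) c _ x hne
      rw [hx] at hdq
      exact hmem ⟨yq, hyq, hdq⟩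
  · by_cases h : ∃ yq ∈ QT i.D (B9GeoLemma21KLevelV1.one_le_Mh i) (four_le_P' i) c,
        (((bondT i.D).dist (β i.hN i.D i.hk a) yq : ℕ) : ℝ) ≤ 2 * (ℓ : ℝ) + 6
    · rw [if_pos h, if_pos h]; ring
    · rw [if_neg h, if_neg h, mul_zero]

end Leibniz

/-! ## §2 The consumer-facing block at generic letters with the cut-off cube terms discharged (CoverCubes re-run) -/

section CoverCubes

/-- ★★★ **THEOREM 3.10 ⇒ THE (3.42) BLOCK OF `kernelFamilyBInv … (GAY i parS parB Gp) …` AT THE COVER OF RECORD, GENERIC CUBE LETTERS, ALL CUT-OFF CUBE TERMS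
AND THE FIRST FAMILY OF `R` DISCHARGED**: `B9Thm310GOfLocalInverse.eBlock_kernelFamilyBInv_GAY_of_localInverse` with `KE ν □`, `A₁` from §1 (`hasMajorant_conj_gradTermB_Oc`,
`sum_gradTermB_majorant_le`), `KF ν □`, `A₂` (`hasMajorant_conj_divTermB_Oc`, `sum_divTermB_majorant_le`, `m_N = e^{αδ₀}c₁(α)` by `card_near_le_of_ineq261`), `KL □`,
`A₃` (`hasMajorant_conj_lapTermB_Oc`, `sum_lapTermB_majorant_le`), for ANY ℝ-linear `D_ν`, `D*_ν`, `L` agreeing with `cdB`, `cdsB`, `lapB` at `U = cfg U₁`.  Displayed: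
`hE`, the defect laws `hdef`∕`hdefT`, `hrest` (families 2–4 + `Σ_□ conj b E_□`), `hV` (transposed families 1–4 + `Σ_□ conj b E♯_□`), `hinvU`, bi-contractivity, plaquette
datum, [4] Lemma 2.1, the two smallness conditions.  Output and constants as CoverCubes (`Bc` term by term).
DEFECT LABEL: the defect family `Σ_□E_□` (resp. `Σ_□E♯_□`) is an (R)-design term, NOT in print; `= 0` for print's `G_□ = (Δ_{loc,□} − DP_□D*)⁻¹` on the cube sequence (p. 409 l. 3–5) and for r05's `GACubeY` letters. [cite: Balaban1985BackgroundPropagators, Thm 3.3 p.399 (3.42) p.397 via Thm 3.10 pp.414–416, (3.100) p.413; Balaban1984PropagatorsII, Prop. 2.2 (2.67) p.234, Lemma 2.1 (2.61) p.234] -/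
theorem eBlock_kernelFamilyBInv_GAY_of_localInverseCubes (hι : ∀ s, β i.hN i.D i.hk (ιB s) = s)
    {M₂ : ℝ} (hM₂ : 0 ≤ M₂) (hrepr : ∀ (v : 𝔸) (j : ι), |b.repr v j| ≤ M₂ * ‖v‖) (hη : etaS i = |i.cf|⁻¹) (hb₁ : 0 ≤ b₁)
    (parS : SiteParY 𝔸 i) (parB : BondParY 𝔸 i) (Gp : SiteOpY 𝔸 i)
    (ζ : ↥(cubes i.D.toDomains) → SiteY i → ℝ) (hζ : ∀ c z, hTY i c z ≠ 0 → ζ c z = 1)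
    (Oc : ↥(cubes i.D.toDomains) → BondOpY 𝔸 i) (Pl P1l E Et : ↥(cubes i.D.toDomains) → Module.End ℂ (FBondY i → 𝔸))
    (hP1 : ∀ c, Pl c * cutMulY (hBdY i (hTY i c)) = cutMulY (hBdY i (hTY i c)) * Pl c + P1l c)
    (hdef : ∀ c, cutMulY (hBdY i (hTY i c)) * (deltaLocY i parB (cfg U₁) - Pl c) * Oc c (cfg U₁) * cutMulY (hBdY i (hTY i c)) =
      cutMulY (hBdY i (hTY i c)) * cutMulY (hBdY i (hTY i c)) - E c)
    (hdefT : ∀ c, cutMulY (hBdY i (hTY i c)) * Oc c (cfg U₁) * (deltaLocY i parB (cfg U₁) - Pl c) * cutMulY (hBdY i (hTY i c)) =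
      cutMulY (hBdY i (hTY i c)) * cutMulY (hBdY i (hTY i c)) - Et c)
    (hinvU : IsUnit (deltaAY i parS parB Gp (cfg U₁)))
    (D Ds : Fin (d + 1) → Module.End ℝ (FBondY i → 𝔸)) (hD : ∀ ν Λ, D ν Λ = cdB i (cfg U₁) ν Λ) (hDs : ∀ ν Λ, Ds ν Λ = cdsB i (cfg U₁) ν Λ)
    (Lp : Module.End ℝ (FBondY i → 𝔸)) (hLp : ∀ Λ, Lp Λ = lapB i (cfg U₁) Λ)
    (d' : ℕ) {δ₀ α Θ' θV B₀ δh : ℝ}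
    (hB₀ : 0 ≤ B₀) (hδ₀ : 0 ≤ δ₀) (hΘ' : 0 ≤ Θ') (hθV : 0 ≤ θV) (hδh : 0 ≤ δh)
    (hαδ : 0 ≤ α * δ₀) (hαδ2 : 0 ≤ (1 - 2 * α) * δ₀)
    (h261 : Ineq261 d' (toB6 (geo9K i) Rr Hp) δ₀ α) (h263 : Ineq263 d' (toB6 (geo9K i) Rr Hp) δ₀ α)
    (hsmall : ((3 * 5 ^ (d + 1) * (Real.exp (α * δ₀ * (2 * (ℓ : ℝ) + 6)) * B6.c1 d' δ₀ α)) *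
        (M₂ * (∑ j, ‖b j‖) * theta389B d ℓ B₀ b₁ δ₀ 1 (2 * δh) (δh * (((ℓ : ℝ) + 1) ^ 2 + 1)) δh 0 * ((geo9K i).M)⁻¹) + Θ') * B6.c1 d' δ₀ α < 1)
    (hsmallV : θV * B6.c1 d' δ₀ α < 1)
    (hE : ∀ c : ↥(cubes i.D.toDomains), EBlock (kernelFamilyBInv i B cfg (Oc c) par) B₀ δ₀ U₁)
    (hU : ∀ μ x, ‖(cfg U₁ μ x : 𝔸)‖ ≤ 1 ∧ ‖(((cfg U₁ μ x)⁻¹ : 𝔸ˣ) : 𝔸)‖ ≤ 1)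
    (hT : ∀ (y : IBondY i) (f : FBondY i), ‖(qT i parB (cfg U₁) y f : 𝔸)‖ ≤ 1 ∧ ‖(((qT i parB (cfg U₁) y f)⁻¹ : 𝔸ˣ) : 𝔸)‖ ≤ 1)
    (hW : ∀ p : PlaqY i, ‖((holY i (cfg U₁) p : 𝔸ˣ) : 𝔸) - 1‖ ≤ δh * ((((ℓ : ℝ) + 1) ^ levY i (chartY i p.src))⁻¹) ^ 2)
    (hrest : HasMajorant (g := toB6 (geo9K i) Rr Hp) (fun p : FBondY i × ι => ιB (blkV1 i.hN i.D p.1))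
      (∑ c, conj b (((1 - cutMulY (hBdY i (ζ c))) * DPDsY i parS Gp (cfg U₁) *
            (cutMulY (hBdY i (hTY i c)) * Oc c (cfg U₁) * cutMulY (hBdY i (hTY i c)))).restrictScalars ℝ)
        + ∑ c, conj b ((cutMulY (hBdY i (ζ c)) * (DPDsY i parS Gp (cfg U₁) - Pl c) *
            (cutMulY (hBdY i (hTY i c)) * Oc c (cfg U₁) * cutMulY (hBdY i (hTY i c)))).restrictScalars ℝ)
        + ∑ c, conj b ((cutMulY (hBdY i (ζ c)) * P1l c * Oc c (cfg U₁) * cutMulY (hBdY i (hTY i c))).restrictScalars ℝ)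
        + ∑ c, conj b ((E c).restrictScalars ℝ))
      (fun a a' => Θ' * Real.exp (-(δ₀ * (geo9K i).dist a a'))))
    (hV : HasMajorant (g := toB6 (geo9K i) Rr Hp) (fun p : FBondY i × ι => ιB (blkV1 i.hN i.D p.1))
      (-(∑ c, conj b ((cutMulY (hBdY i (hTY i c)) * Oc c (cfg U₁) * KhBY i (hTY i c) parB (cfg U₁)).restrictScalars ℝ))
        - ∑ c, conj b ((cutMulY (hBdY i (hTY i c)) * Oc c (cfg U₁) * P1l c).restrictScalars ℝ)
        + ∑ c, conj b ((cutMulY (hBdY i (hTY i c)) * Oc c (cfg U₁) * cutMulY (hBdY i (hTY i c)) *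
            (cutMulY (hBdY i (ζ c)) * (DPDsY i parS Gp (cfg U₁) - Pl c))).restrictScalars ℝ)
        + ∑ c, conj b ((cutMulY (hBdY i (hTY i c)) * Oc c (cfg U₁) * cutMulY (hBdY i (hTY i c)) *
            ((1 - cutMulY (hBdY i (ζ c))) * DPDsY i parS Gp (cfg U₁))).restrictScalars ℝ)
        + ∑ c, conj b ((Et c).restrictScalars ℝ))
      (fun a a' => θV * (geo9K i).len a * ((geo9K i).len a')⁻¹ * Real.exp (-(δ₀ * (geo9K i).dist a a')))) :
    EBlock (kernelFamilyBInv i B cfg (GAY i parS parB Gp) par)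
      (M₂ * (∑ j, ‖b j‖) *
        ((3 * 5 ^ (d + 1)) * (M₂ * (∑ j, ‖b j‖) * B₀) * B6.c1 d' δ₀ α *
            (1 - ((3 * 5 ^ (d + 1) * (Real.exp (α * δ₀ * (2 * (ℓ : ℝ) + 6)) * B6.c1 d' δ₀ α)) *
              (M₂ * (∑ j, ‖b j‖) * theta389B d ℓ B₀ b₁ δ₀ 1 (2 * δh) (δh * (((ℓ : ℝ) + 1) ^ 2 + 1)) δh 0 * ((geo9K i).M)⁻¹) + Θ') *
              B6.c1 d' δ₀ α)⁻¹ +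
          ((3 * 5 ^ (d + 1) * (Real.exp (α * δ₀ * (2 * (ℓ : ℝ) + 6)) * B6.c1 d' δ₀ α)) *
              (M₂ * (∑ j, ‖b j‖) * (B₀ * (1 + 5 * C1F d ℓ * (((ℓ : ℝ) + 1) * Real.exp δ₀) / (8 * (i.Mh : ℝ)))))) * B6.c1 d' δ₀ α *
            (1 - ((3 * 5 ^ (d + 1) * (Real.exp (α * δ₀ * (2 * (ℓ : ℝ) + 6)) * B6.c1 d' δ₀ α)) *
              (M₂ * (∑ j, ‖b j‖) * theta389B d ℓ B₀ b₁ δ₀ 1 (2 * δh) (δh * (((ℓ : ℝ) + 1) ^ 2 + 1)) δh 0 * ((geo9K i).M)⁻¹) + Θ') *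
              B6.c1 d' δ₀ α)⁻¹ +
          ((3 * 5 ^ (d + 1) * (Real.exp (α * δ₀ * (2 * (ℓ : ℝ) + 6)) * B6.c1 d' δ₀ α)) *
              (M₂ * (∑ j, ‖b j‖) * (B₀ * (1 + Real.exp (α * δ₀) * B6.c1 d' δ₀ α * Real.exp δ₀ * (5 / 8 * C1F d ℓ / i.Mh))))) * B6.c1 d' δ₀ α *
            (1 - θV * B6.c1 d' δ₀ α)⁻¹ +
          ((3 * 5 ^ (d + 1) * (Real.exp (α * δ₀ * (2 * (ℓ : ℝ) + 6)) * B6.c1 d' δ₀ α)) *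
              (M₂ * (∑ j, ‖b j‖) * (B₀ * (1 + ((d : ℝ) + 1) * (5 / 8 * C1F d ℓ / i.Mh * (Real.exp δ₀ + 1) + 25 / 64 * C2F d ℓ / i.Mh ^ 2))))) * B6.c1 d' δ₀ α *
            (1 - ((3 * 5 ^ (d + 1) * (Real.exp (α * δ₀ * (2 * (ℓ : ℝ) + 6)) * B6.c1 d' δ₀ α)) *
              (M₂ * (∑ j, ‖b j‖) * theta389B d ℓ B₀ b₁ δ₀ 1 (2 * δh) (δh * (((ℓ : ℝ) + 1) ^ 2 + 1)) δh 0 * ((geo9K i).M)⁻¹) + Θ') *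
              B6.c1 d' δ₀ α)⁻¹))
      ((1 - 2 * α) * δ₀) U₁ := by
  classical
  have hSb : 0 ≤ ∑ j, ‖b j‖ := Finset.sum_nonneg fun _ _ => norm_nonneg _
  have hC1F : 0 ≤ C1F d ℓ := C1F_nonneg d ℓ
  have hC2F : 0 ≤ C2F d ℓ := C2F_nonneg d ℓ
  have hc1 : 0 ≤ B6.c1 d' δ₀ α := c1_nonneg d' δ₀ α
  have hN' : 0 ≤ 3 * 5 ^ (d + 1) * (Real.exp (α * δ₀ * (2 * (ℓ : ℝ) + 6)) * B6.c1 d' δ₀ α) := by positivity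
  have hmN : 0 ≤ Real.exp (α * δ₀) * B6.c1 d' δ₀ α := by positivity
  have hA₁ : 0 ≤ (3 * 5 ^ (d + 1) * (Real.exp (α * δ₀ * (2 * (ℓ : ℝ) + 6)) * B6.c1 d' δ₀ α)) *
      (M₂ * (∑ j, ‖b j‖) * (B₀ * (1 + 5 * C1F d ℓ * (((ℓ : ℝ) + 1) * Real.exp δ₀) / (8 * (i.Mh : ℝ))))) :=
    mul_nonneg hN' (mul_nonneg (mul_nonneg hM₂ hSb) (mul_nonneg hB₀ (by positivity)))
  have hA₂ : 0 ≤ (3 * 5 ^ (d + 1) * (Real.exp (α * δ₀ * (2 * (ℓ : ℝ) + 6)) * B6.c1 d' δ₀ α)) *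
      (M₂ * (∑ j, ‖b j‖) * (B₀ * (1 + Real.exp (α * δ₀) * B6.c1 d' δ₀ α * Real.exp δ₀ * (5 / 8 * C1F d ℓ / i.Mh)))) :=
    mul_nonneg hN' (mul_nonneg (mul_nonneg hM₂ hSb) (mul_nonneg hB₀ (by positivity)))
  have hA₃ : 0 ≤ (3 * 5 ^ (d + 1) * (Real.exp (α * δ₀ * (2 * (ℓ : ℝ) + 6)) * B6.c1 d' δ₀ α)) *
      (M₂ * (∑ j, ‖b j‖) * (B₀ * (1 + ((d : ℝ) + 1) * (5 / 8 * C1F d ℓ / i.Mh * (Real.exp δ₀ + 1) + 25 / 64 * C2F d ℓ / i.Mh ^ 2)))) :=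
    mul_nonneg hN' (mul_nonneg (mul_nonneg hM₂ hSb) (mul_nonneg hB₀ (by positivity)))
  -- the neighbourhood count `m_N` of FILE 4b-B from (2.61)
  have hnbr : ∀ y' : IBondY i, ((((Finset.univ : Finset ((geo9K i).Site)).filter fun a => (geo9K i).dist a y' ≤ 1).card : ℕ) : ℝ) ≤
      Real.exp (α * δ₀) * B6.c1 d' δ₀ α := fun y' => card_near_le_of_ineq261 i d' hαδ h261 y'
  exact eBlock_kernelFamilyBInv_GAY_of_localInverse i b ιB cfg par hι hM₂ hrepr hη hb₁ parS parB Gp ζ hζ Oc Pl P1l E Et hP1 hdef hdefT hinvU D Ds hD hDs Lp hLp d'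
    (fun ν c => fun a a' => if (∃ y ∈ QT i.D (B9GeoLemma21KLevelV1.one_le_Mh i) (four_le_P' i) c,
          (((bondT i.D).dist (β i.hN i.D i.hk a) y : ℕ) : ℝ) ≤ 2 * (ℓ : ℝ) + 6)
        then M₂ * (∑ j, ‖b j‖) * (B₀ * (1 + 5 * C1F d ℓ * (((ℓ : ℝ) + 1) * Real.exp δ₀) / (8 * (i.Mh : ℝ)))) * (geo9K i).len a
          * Real.exp (-(δ₀ * (geo9K i).dist a a')) else 0)
    (fun ν c => fun a a' => if (∃ y ∈ QT i.D (B9GeoLemma21KLevelV1.one_le_Mh i) (four_le_P' i) c,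
          (((bondT i.D).dist (β i.hN i.D i.hk a) y : ℕ) : ℝ) ≤ 2 * (ℓ : ℝ) + 6)
        then M₂ * (∑ j, ‖b j‖) * (B₀ * (1 + Real.exp (α * δ₀) * B6.c1 d' δ₀ α * Real.exp δ₀ * (5 / 8 * C1F d ℓ / i.Mh))) * (geo9K i).len a
          * Real.exp (-(δ₀ * (geo9K i).dist a a')) else 0)
    (fun c => fun a a' => if (∃ y ∈ QT i.D (B9GeoLemma21KLevelV1.one_le_Mh i) (four_le_P' i) c,
          (((bondT i.D).dist (β i.hN i.D i.hk a) y : ℕ) : ℝ) ≤ 2 * (ℓ : ℝ) + 6)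
        then M₂ * (∑ j, ‖b j‖) * (B₀ * (1 + ((d : ℝ) + 1) * (5 / 8 * C1F d ℓ / i.Mh * (Real.exp δ₀ + 1) + 25 / 64 * C2F d ℓ / i.Mh ^ 2)))
          * Real.exp (-(δ₀ * (geo9K i).dist a a')) else 0)
    hB₀ hδ₀ hΘ' hθV hδh hA₁ hA₂ hA₃ hαδ hαδ2 h261 h263 hsmall hsmallV hE hU hT hW hrest
    (fun ν c => hasMajorant_conj_gradTermB_Oc i b ιB cfg par (Rr := Rr) (Hp := Hp) hι hM₂ hrepr hη Oc hB₀ hδ₀ c (hE c) hU ν (D ν) (hD ν))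
    (fun ν a a' => sum_gradTermB_majorant_le i b ιB (Rr := Rr) (Hp := Hp) hι hM₂ hB₀ d' hαδ h261 a a')
    (fun c => hasMajorant_conj_lapTermB_Oc i b ιB cfg par (Rr := Rr) (Hp := Hp) hι hM₂ hrepr hη Oc hB₀ hδ₀ c (hE c) hU Lp hLp)
    (fun a a' => sum_lapTermB_majorant_le i b ιB (Rr := Rr) (Hp := Hp) hι hM₂ hB₀ d' hαδ h261 a a')
    (fun ν c => hasMajorant_conj_divTermB_Oc i b ιB cfg par (Rr := Rr) (Hp := Hp) hι hM₂ hrepr hη Oc hB₀ hδ₀ c (hE c) hU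
      (fun y' : IBondY i => ((Finset.univ : Finset ((geo9K i).Site)).filter fun a => (geo9K i).dist a y' ≤ 1))
      (fun a y' h => Finset.mem_filter.2 ⟨Finset.mem_univ (α := (geo9K i).Site) a, h⟩) hmN hnbr ν (Ds ν) (hDs ν))
    (fun ν a a' => sum_divTermB_majorant_le i b ιB (Rr := Rr) (Hp := Hp) hι hM₂ hB₀ hmN d' hαδ h261 a a')
    hV

end CoverCubes

/-! ## §3 The first family of the transposed remainder at generic letters (T3 §4–§5 re-run) -/

section Transposed

omit [Fintype ι] [DecidableEq ι] [Fintype (geo9K i).Site] [DecidableEq (geo9K i).Site] in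
/-- a linear map with a majorant keeps it under negation (bookkeeping; the private twin in T3 is not exported). [cite: Balaban1984PropagatorsII, (2.51) p.232, bookkeeping] -/
private theorem hasMajorant_neg' {g : B6.Geometry} {X : Type} (blk : X → g.Site) {T : Module.End ℝ (X → ℝ)} {K : g.Site → g.Site → ℝ}
    (h : HasMajorant (g := g) blk T K) : HasMajorant (g := g) blk (-T) K := by
  intro y' μ Bμ hμ x
  rw [LinearMap.neg_apply, Pi.neg_apply, abs_neg]
  exact h y' μ Bμ hμ x

omit [DecidableEq ι] [DecidableEq (geo9K i).Site] in
/-- ★★ **THE SCALE-WEIGHTED BLOCK MAJORANT OF ONE TRANSPOSED COMMUTATOR TERM `conj b (h_□O_□(U)K(h_□)(U))` AT A GENERIC CUBE LETTER, FROM ITS (3.42) BLOCK OVER THE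
CLASS** (T3 §4 re-run; engine T2's `norm_hTY_O_KhBY_apply_le`, letter-generic): on the localisation set `S′_□ = {a : ∃ y ∈ QT □, d_T(βa, y) ≤ 2L+6}` the majorant
`1_{S′_□}(a)·M₂(Σ‖b_j‖)·θ_Tᴮ·L⁵·ℓ(a)·ℓ(a′)⁻¹·e^{−δ₀d(a,a′)}` — output level `≥ j − 1`, input level `≤ j + 4` by the input locality of `K(h_□)`, so `1 ≤ L⁵ℓ(a)∕ℓ(a′)`.
[cite: Balaban1985BackgroundPropagators, p.414 l.33–35, (3.89) p.409, Thm 3.3 (3.42) p.397, (3.100)–(3.104) pp.413–414; Balaban1984PropagatorsII, (2.51) p.232, Lemma 2.1 (2.61) p.234] -/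
theorem hasMajorant_conj_transposedCommB_Oc (hι : ∀ s, β i.hN i.D i.hk (ιB s) = s)
    {M₂ : ℝ} (hM₂ : 0 ≤ M₂) (hrepr : ∀ (v : 𝔸) (j : ι), |b.repr v j| ≤ M₂ * ‖v‖) (hη : etaS i = |i.cf|⁻¹)
    (Oc : ↥(cubes i.D.toDomains) → BondOpY 𝔸 i) (parB : BondParY 𝔸 i) {B₀ δ₀ : ℝ} (hB₀ : 0 ≤ B₀) (hδ₀ : 0 ≤ δ₀)
    (c : ↥(cubes i.D.toDomains)) (hE : EBlock (kernelFamilyBInv i B cfg (Oc c) par) B₀ δ₀ U₁)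
    (hU : ∀ μ x, ‖(cfg U₁ μ x : 𝔸)‖ ≤ 1 ∧ ‖(((cfg U₁ μ x)⁻¹ : 𝔸ˣ) : 𝔸)‖ ≤ 1)
    (hT : ∀ (y : IBondY i) (f : FBondY i), ‖(qT i parB (cfg U₁) y f : 𝔸)‖ ≤ 1 ∧ ‖(((qT i parB (cfg U₁) y f)⁻¹ : 𝔸ˣ) : 𝔸)‖ ≤ 1)
    {δh : ℝ} (hδh : 0 ≤ δh)
    (hW : ∀ p : PlaqY i, ‖((holY i (cfg U₁) p : 𝔸ˣ) : 𝔸) - 1‖ ≤ δh * ((((ℓ : ℝ) + 1) ^ levY i (chartY i p.src))⁻¹) ^ 2)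
    (T₂ : IBondY i → Finset (IBondY i)) (hT₂ : ∀ a y' : IBondY i, (geo9K i).dist a y' ≤ 2 → a ∈ T₂ y')
    {m₂ : ℝ} (hm₂ : 0 ≤ m₂) (hnbr₂ : ∀ y' : IBondY i, ((T₂ y').card : ℝ) ≤ m₂)
    (TQ : IBondY i → Finset (IBondY i)) (hTQ : ∀ a y' : IBondY i, (geo9K i).dist a y' ≤ 2 * (ℓ : ℝ) + 6 → a ∈ TQ y')
    {mQ : ℝ} (hmQ : 0 ≤ mQ) (hnbrQ : ∀ y' : IBondY i, ((TQ y').card : ℝ) ≤ mQ) :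
    HasMajorant (g := toB6 (geo9K i) Rr Hp) (fun p : FBondY i × ι => ιB (blkV1 i.hN i.D p.1))
      (conj b ((cutMulY (hBdY i (hTY i c)) * Oc c (cfg U₁) * KhBY i (hTY i c) parB (cfg U₁)).restrictScalars ℝ))
      (fun a a' => if (∃ y ∈ QT i.D (B9GeoLemma21KLevelV1.one_le_Mh i) (four_le_P' i) c,
          (((bondT i.D).dist (β i.hN i.D i.hk a) y : ℕ) : ℝ) ≤ 2 * (ℓ : ℝ) + 6)
        then M₂ * (∑ j, ‖b j‖) *
          ((B₀ * (((d : ℝ) + 1) * m₂ * Real.exp (δ₀ * 2)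
              * ((2 * ((d : ℝ) + 1) + 4) * (5 / 8 * C1F d ℓ / i.Mh) + (5 / 8) ^ 2 * (C2F d ℓ + 2 * C2X d ℓ) / (i.Mh : ℝ) ^ 2
                  + 8 * δh * ((ℓ : ℝ) + 1) ^ 5 * (5 / 8 * C1F d ℓ / i.Mh) + 64 * δh * ((ℓ : ℝ) + 1) ^ 7 * (5 / 8 * C1F d ℓ / i.Mh))
            + mQ * Real.exp (δ₀ * (2 * (ℓ : ℝ) + 6))
              * (4 * b₁ * ((ℓ : ℝ) + 1) ^ 6 * (((ℓ : ℝ) + 1) ^ (d + 1)) ^ 5 * (sLipT d ℓ / (((ℓ : ℝ) + 1) * i.Mh) * (((ℓ : ℝ) + 1) + 3)))))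
            * ((ℓ : ℝ) + 1) ^ 5) *
          ((geo9K i).len a * ((geo9K i).len a')⁻¹) * Real.exp (-(δ₀ * (geo9K i).dist a a'))
        else 0) := by
  classical
  obtain ⟨_, hMh2, hR2, _⟩ := side_conditions i
  have hM : (0 : ℝ) < i.Mh := by exact_mod_cast (lt_of_lt_of_le (by norm_num) hMh2)
  have hC1 : 0 ≤ C1F d ℓ := C1F_nonneg d ℓ
  have hC2 : 0 ≤ C2F d ℓ := C2F_nonneg d ℓ
  have hC2X : 0 ≤ C2X d ℓ := (C2X_bounds d ℓ).2.2
  have hsL : 0 ≤ sLipT d ℓ := sLipT_nonneg d ℓ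
  set U : CfgY 𝔸 i := cfg U₁ with hUdef
  set O := Oc c U with hOdef
  set θT : ℝ := B₀ * (((d : ℝ) + 1) * m₂ * Real.exp (δ₀ * 2)
      * ((2 * ((d : ℝ) + 1) + 4) * (5 / 8 * C1F d ℓ / i.Mh) + (5 / 8) ^ 2 * (C2F d ℓ + 2 * C2X d ℓ) / (i.Mh : ℝ) ^ 2
          + 8 * δh * ((ℓ : ℝ) + 1) ^ 5 * (5 / 8 * C1F d ℓ / i.Mh) + 64 * δh * ((ℓ : ℝ) + 1) ^ 7 * (5 / 8 * C1F d ℓ / i.Mh))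
    + mQ * Real.exp (δ₀ * (2 * (ℓ : ℝ) + 6))
      * (4 * b₁ * ((ℓ : ℝ) + 1) ^ 6 * (((ℓ : ℝ) + 1) ^ (d + 1)) ^ 5 * (sLipT d ℓ / (((ℓ : ℝ) + 1) * i.Mh) * (((ℓ : ℝ) + 1) + 3)))) with hθT
  have hb1 : ∀ a : IBondY i, 0 ≤ b₁ := fun a => (b1_pos i a).le
  -- the operator as ONE ℝ-linear letter, ℂ-homogeneous
  set Rl : Module.End ℝ (FBondY i → 𝔸) :=
    (cutMulY (hBdY i (hTY i c)) * Oc c (cfg U₁) * KhBY i (hTY i c) parB (cfg U₁)).restrictScalars ℝ with hRl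
  have hRl_apply : ∀ Λ, Rl Λ = cutMulY (hBdY i (hTY i c)) (O (KhBY i (hTY i c) parB U Λ)) := fun Λ => rfl
  have hTc : ∀ (cx : ℂ) (Λ : FBondY i → 𝔸), Rl (cx • Λ) = cx • Rl Λ := fun cx Λ => by
    rw [hRl, LinearMap.restrictScalars_apply, LinearMap.restrictScalars_apply, map_smul]
  have hlen0 : ∀ a : IBondY i, 0 ≤ (geo9K i).len a := fun a => (B6KLevelCensusIndexV1.len_pos i a).le
  have hW0 : ∀ a a' : IBondY i, 0 ≤ (if (∃ y ∈ QT i.D (B9GeoLemma21KLevelV1.one_le_Mh i) (four_le_P' i) c,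
        (((bondT i.D).dist (β i.hN i.D i.hk a) y : ℕ) : ℝ) ≤ 2 * (ℓ : ℝ) + 6)
      then θT * ((ℓ : ℝ) + 1) ^ 5 * ((geo9K i).len a * ((geo9K i).len a')⁻¹) * Real.exp (-(δ₀ * (geo9K i).dist a a')) else 0) := by
    intro a a'
    have := hb1 a
    split_ifs
    · exact mul_nonneg (mul_nonneg (by positivity) (mul_nonneg (hlen0 a) (inv_nonneg.2 (hlen0 a')))) (Real.exp_pos _).le
    · exact le_rfl
  have h342₀ := h342₀_of_eBlockInvB i b cfg (Oc c) par hE hM₂ hrepr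
  have h342₂ := h342₂_of_eBlockInvB i b cfg (Oc c) par hE hM₂ hrepr
  have hTW : ∀ (J : FBondY i → ℝ) (y y' : IBondY i), (geo9K i).suppIn (Sum.inr J) y' → ∀ E : 𝔸, ‖E‖ ≤ 1 →
      ∀ x : FBondY i, blkV1 i.hN i.D x = β i.hN i.D i.hk y → ‖Rl (liftY J E) x‖
        ≤ (if (∃ yq ∈ QT i.D (B9GeoLemma21KLevelV1.one_le_Mh i) (four_le_P' i) c,
              (((bondT i.D).dist (β i.hN i.D i.hk y) yq : ℕ) : ℝ) ≤ 2 * (ℓ : ℝ) + 6)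
            then θT * ((ℓ : ℝ) + 1) ^ 5 * ((geo9K i).len y * ((geo9K i).len y')⁻¹) * Real.exp (-(δ₀ * (geo9K i).dist y y')) else 0)
          * (geo9K i).supNorm (Sum.inr J) := by
    intro J y y' hs E hE x hx
    have hS0 : 0 ≤ (geo9K i).supNorm (Sum.inr J) := geo9K_supNorm_nonneg i _
    rw [hRl_apply]
    by_cases h0 : cutMulY (hBdY i (hTY i c)) (O (KhBY i (hTY i c) parB U (liftY J E))) x = 0
    · rw [h0, norm_zero]; exact mul_nonneg (hW0 y y') hS0
    -- the term is non-zero: `h_□(x₋) ≠ 0`, so `Δ(x) = βy ∈ QT □` (level `≥ j − 1`) …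
    have hx0 : hTY i c (chartY i x.src) ≠ 0 := by
      intro hz; apply h0; rw [cutMulY_apply, hBdY_apply, hz, Complex.ofReal_zero, zero_smul]
    have hQT : blkOf i.D.toDomains (chartY i x.src) ∈ QT i.D (B9GeoLemma21KLevelV1.one_le_Mh i) (four_le_P' i) c :=
      blkOf_mem_QT_of_hT_ne_zero hMh2 hR2 (four_le_P' i) c hx0
    have hQTy : β i.hN i.D i.hk y ∈ QT i.D (B9GeoLemma21KLevelV1.one_le_Mh i) (four_le_P' i) c := by rw [← hx]; exact hQT
    have hmem : ∃ yq ∈ QT i.D (B9GeoLemma21KLevelV1.one_le_Mh i) (four_le_P' i) c,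
        (((bondT i.D).dist (β i.hN i.D i.hk y) yq : ℕ) : ℝ) ≤ 2 * (ℓ : ℝ) + 6 := by
      refine ⟨β i.hN i.D i.hk y, hQTy, ?_⟩
      rw [SimpleGraph.dist_self, Nat.cast_zero]; positivity
    have hlo : c.1.1 ≤ lvl i.hN i.D i.hk y + 1 := by
      have h := lvl_ge_of_mem_QT i c hQTy
      rwa [beta_level i.hN i.D i.hk (le_trans one_le_two i.hk2)] at h
    -- … and `K(h_□)Λ ≠ 0` somewhere, so the input block has level `≤ j + 4`
    have hK : KhBY i (hTY i c) parB U (liftY J E) ≠ 0 := by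
      intro hz; apply h0; rw [hz, map_zero, cutMulY_apply, Pi.zero_apply, smul_zero]
    obtain ⟨b'', hb''⟩ := Function.ne_iff.1 hK
    have hlev'' : levY i (chartY i b''.src) ≤ c.1.1 + 2 := levY_src_le_of_KhBY_hTY_ne_zero i c parB U (liftY J E) b'' hb''
    obtain ⟨f, hf, hlevf⟩ := exists_input_of_KhBY_ne_zero i c parB U hU (liftY J E) b'' hb''
    have hJf : J f ≠ 0 := by
      intro hJ0; apply hf; rw [liftY_apply, hJ0, Complex.ofReal_zero, zero_smul]
    have hblkf : blkV1 i.hN i.D f = β i.hN i.D i.hk y' := hs f hJf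
    have hlvly' : levY i (chartY i f.src) = lvl i.hN i.D i.hk y' := levY_eq_lvl_of_blkOf_eq i hblkf
    have hwin : lvl i.hN i.D i.hk y' ≤ lvl i.hN i.D i.hk y + 5 := by omega
    have hratio : 1 ≤ ((ℓ : ℝ) + 1) ^ 5 * (geo9K i).len y * ((geo9K i).len y')⁻¹ := one_le_pow_mul_len_ratio i hη hwin
    rw [if_pos hmem]
    have hmain := norm_hTY_O_KhBY_apply_le i c parB U O hB₀ hδ₀ hη ιB hι hU hT hδh hW h342₀ h342₂ T₂ hT₂ hm₂ hnbr₂ TQ hTQ hmQ hnbrQ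
      J y y' hs (liftY J E) (norm_liftY_le_abs i J hE) x hx
    have hb1y := hb1 y
    have hθT0 : 0 ≤ θT := by positivity
    have hP0 : 0 ≤ θT * Real.exp (-(δ₀ * (geo9K i).dist y y')) * (geo9K i).supNorm (Sum.inr J) := by positivity
    refine hmain.trans ?_
    calc θT * Real.exp (-(δ₀ * (geo9K i).dist y y')) * (geo9K i).supNorm (Sum.inr J)
        = 1 * (θT * Real.exp (-(δ₀ * (geo9K i).dist y y')) * (geo9K i).supNorm (Sum.inr J)) := (one_mul _).symm
      _ ≤ (((ℓ : ℝ) + 1) ^ 5 * (geo9K i).len y * ((geo9K i).len y')⁻¹) *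
            (θT * Real.exp (-(δ₀ * (geo9K i).dist y y')) * (geo9K i).supNorm (Sum.inr J)) := mul_le_mul_of_nonneg_right hratio hP0
      _ = _ := by ring
  have h := hasMajorant_conj_of_ball_boundB (Rr := Rr) (Hp := Hp) i b Rl hTc ιB hι hM₂ hrepr _ hW0 hTW
  refine hasMajorant_mono (g := toB6 (geo9K i) Rr Hp) _ h fun a a' => le_of_eq ?_
  show M₂ * (∑ j, ‖b j‖) * (if (∃ y ∈ QT i.D (B9GeoLemma21KLevelV1.one_le_Mh i) (four_le_P' i) c,
        (((bondT i.D).dist (β i.hN i.D i.hk a) y : ℕ) : ℝ) ≤ 2 * (ℓ : ℝ) + 6)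
      then θT * ((ℓ : ℝ) + 1) ^ 5 * ((geo9K i).len a * ((geo9K i).len a')⁻¹) * Real.exp (-(δ₀ * (geo9K i).dist a a')) else 0) = _
  split_ifs
  · ring
  · rw [mul_zero]

omit [DecidableEq ι] [DecidableEq (geo9K i).Site] in
/-- ★★ **THE FIRST FAMILY OF THE TRANSPOSED REMAINDER, SUMMED OVER THE COVER, GENERIC CUBE LETTERS**: `Σ_□ conj b (h_□O_□(U)K(h_□)(U))` has the majorant
`N′·M₂(Σ‖b_j‖)·θ_Tᴮ·L⁵·ℓ(a)·ℓ(a′)⁻¹·e^{−δ₀d(a,a′)}`, `N′ = 3·5^{d+1}·e^{αδ₀(2L+6)}·c₁(α)` (T3 §5 re-run; `sum_transposedCommB_majorant_le` by name; [4] p. 232 «A summation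
preserves it also»). [cite: Balaban1985BackgroundPropagators, p.414 l.33–35, p.415 l.6, (3.89) p.409; Balaban1984PropagatorsII, (2.51) p.232, Prop. 2.2 (2.65) p.234, Lemma 2.1 (2.61) p.234] -/
theorem hasMajorant_sum_conj_transposedCommB_Oc (hι : ∀ s, β i.hN i.D i.hk (ιB s) = s)
    {M₂ : ℝ} (hM₂ : 0 ≤ M₂) (hrepr : ∀ (v : 𝔸) (j : ι), |b.repr v j| ≤ M₂ * ‖v‖) (hη : etaS i = |i.cf|⁻¹)
    (Oc : ↥(cubes i.D.toDomains) → BondOpY 𝔸 i) (parB : BondParY 𝔸 i) {B₀ δ₀ : ℝ} (hB₀ : 0 ≤ B₀) (hδ₀ : 0 ≤ δ₀)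
    (hE : ∀ c : ↥(cubes i.D.toDomains), EBlock (kernelFamilyBInv i B cfg (Oc c) par) B₀ δ₀ U₁)
    (hU : ∀ μ x, ‖(cfg U₁ μ x : 𝔸)‖ ≤ 1 ∧ ‖(((cfg U₁ μ x)⁻¹ : 𝔸ˣ) : 𝔸)‖ ≤ 1)
    (hT : ∀ (y : IBondY i) (f : FBondY i), ‖(qT i parB (cfg U₁) y f : 𝔸)‖ ≤ 1 ∧ ‖(((qT i parB (cfg U₁) y f)⁻¹ : 𝔸ˣ) : 𝔸)‖ ≤ 1)
    {δh : ℝ} (hδh : 0 ≤ δh)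
    (hW : ∀ p : PlaqY i, ‖((holY i (cfg U₁) p : 𝔸ˣ) : 𝔸) - 1‖ ≤ δh * ((((ℓ : ℝ) + 1) ^ levY i (chartY i p.src))⁻¹) ^ 2)
    (T₂ : IBondY i → Finset (IBondY i)) (hT₂ : ∀ a y' : IBondY i, (geo9K i).dist a y' ≤ 2 → a ∈ T₂ y')
    {m₂ : ℝ} (hm₂ : 0 ≤ m₂) (hnbr₂ : ∀ y' : IBondY i, ((T₂ y').card : ℝ) ≤ m₂)
    (TQ : IBondY i → Finset (IBondY i)) (hTQ : ∀ a y' : IBondY i, (geo9K i).dist a y' ≤ 2 * (ℓ : ℝ) + 6 → a ∈ TQ y')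
    {mQ : ℝ} (hmQ : 0 ≤ mQ) (hnbrQ : ∀ y' : IBondY i, ((TQ y').card : ℝ) ≤ mQ)
    (d' : ℕ) {α : ℝ} (hαδ : 0 ≤ α * δ₀) (h261 : Ineq261 d' (toB6 (geo9K i) Rr Hp) δ₀ α) :
    HasMajorant (g := toB6 (geo9K i) Rr Hp) (fun p : FBondY i × ι => ιB (blkV1 i.hN i.D p.1))
      (∑ c : ↥(cubes i.D.toDomains),
        conj b ((cutMulY (hBdY i (hTY i c)) * Oc c (cfg U₁) * KhBY i (hTY i c) parB (cfg U₁)).restrictScalars ℝ))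
      (fun a a' => (3 * 5 ^ (d + 1) * (Real.exp (α * δ₀ * (2 * (ℓ : ℝ) + 6)) * B6.c1 d' δ₀ α)) *
          (M₂ * (∑ j, ‖b j‖) *
            ((B₀ * (((d : ℝ) + 1) * m₂ * Real.exp (δ₀ * 2)
                * ((2 * ((d : ℝ) + 1) + 4) * (5 / 8 * C1F d ℓ / i.Mh) + (5 / 8) ^ 2 * (C2F d ℓ + 2 * C2X d ℓ) / (i.Mh : ℝ) ^ 2
                    + 8 * δh * ((ℓ : ℝ) + 1) ^ 5 * (5 / 8 * C1F d ℓ / i.Mh) + 64 * δh * ((ℓ : ℝ) + 1) ^ 7 * (5 / 8 * C1F d ℓ / i.Mh))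
              + mQ * Real.exp (δ₀ * (2 * (ℓ : ℝ) + 6))
                * (4 * b₁ * ((ℓ : ℝ) + 1) ^ 6 * (((ℓ : ℝ) + 1) ^ (d + 1)) ^ 5 * (sLipT d ℓ / (((ℓ : ℝ) + 1) * i.Mh) * (((ℓ : ℝ) + 1) + 3)))))
              * ((ℓ : ℝ) + 1) ^ 5)) *
        (geo9K i).len a * ((geo9K i).len a')⁻¹ * Real.exp (-(δ₀ * (geo9K i).dist a a'))) := by
  classical
  obtain ⟨_, hMh2, _, _⟩ := side_conditions i
  have hM : (0 : ℝ) < i.Mh := by exact_mod_cast (lt_of_lt_of_le (by norm_num) hMh2)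
  have hC1 : 0 ≤ C1F d ℓ := C1F_nonneg d ℓ
  have hC2 : 0 ≤ C2F d ℓ := C2F_nonneg d ℓ
  have hC2X : 0 ≤ C2X d ℓ := (C2X_bounds d ℓ).2.2
  have hsL : 0 ≤ sLipT d ℓ := sLipT_nonneg d ℓ
  have hSb : 0 ≤ ∑ j, ‖b j‖ := Finset.sum_nonneg fun _ _ => norm_nonneg _
  have hsum := B9Thm37Sum.hasMajorant_finsetSum (G := toB6 (geo9K i) Rr Hp) (fun p : FBondY i × ι => ιB (blkV1 i.hN i.D p.1))
    (Finset.univ : Finset ↥(cubes i.D.toDomains)) _ _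
    fun c _ => hasMajorant_conj_transposedCommB_Oc i b ιB cfg par (Rr := Rr) (Hp := Hp) hι hM₂ hrepr hη Oc parB hB₀ hδ₀ c (hE c) hU hT hδh hW
      T₂ hT₂ hm₂ hnbr₂ TQ hTQ hmQ hnbrQ
  refine hasMajorant_mono (g := toB6 (geo9K i) Rr Hp) _ hsum fun a a' => ?_
  have hb1 : 0 ≤ b₁ := (b1_pos i a).le
  have hK0 : 0 ≤ M₂ * (∑ j, ‖b j‖) *
      ((B₀ * (((d : ℝ) + 1) * m₂ * Real.exp (δ₀ * 2)
          * ((2 * ((d : ℝ) + 1) + 4) * (5 / 8 * C1F d ℓ / i.Mh) + (5 / 8) ^ 2 * (C2F d ℓ + 2 * C2X d ℓ) / (i.Mh : ℝ) ^ 2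
              + 8 * δh * ((ℓ : ℝ) + 1) ^ 5 * (5 / 8 * C1F d ℓ / i.Mh) + 64 * δh * ((ℓ : ℝ) + 1) ^ 7 * (5 / 8 * C1F d ℓ / i.Mh))
        + mQ * Real.exp (δ₀ * (2 * (ℓ : ℝ) + 6))
          * (4 * b₁ * ((ℓ : ℝ) + 1) ^ 6 * (((ℓ : ℝ) + 1) ^ (d + 1)) ^ 5 * (sLipT d ℓ / (((ℓ : ℝ) + 1) * i.Mh) * (((ℓ : ℝ) + 1) + 3)))))
        * ((ℓ : ℝ) + 1) ^ 5) := by positivity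
  exact sum_transposedCommB_majorant_le i ιB hι d' hαδ h261 hK0 a a'

end Transposed

/-! ## §4 The endpoint of the (QB1) re-cut: the block with the transposed family 1 discharged (T3 §6 re-run) -/

section Endpoint

/-- ★★★ **THEOREM 3.10 ⇒ THE (3.42) BLOCK OF `kernelFamilyBInv … (GAY i parS parB Gp) …` AT THE COVER OF RECORD, WITH THE CUBE LETTERS AN ARBITRARY FAMILY `O_□`, ALL
CUT-OFF CUBE TERMS AND THE FIRST FAMILIES OF `R` AND OF THE TRANSPOSED REMAINDER DISCHARGED — THE ENDPOINT OF THE (QB1) RE-CUT** (T3's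
`eBlock_kernelFamilyBInv_GAY_of_coverCubes'` with `GACubeY ↦ Oc`, `DP_□D* ↦ Pl`, `P_{□,1}(∂h_□) ↦ P1l`, `hinvC ↦ (hdef, hdefT)`).  DISPLAYED: the letters' (3.42) blocks
`hE` at `U₁`; the (3.101) commutator law `hP1` and the two local-inverse laws up to defects `hdef`∕`hdefT` (algebra of the chosen letters; `E = E♯ = 0` for print's
letters and for r05's `GACubeY` by `B9Eq3105OfLocalInverse.hdef_GACubeY`∕`hdefT_GACubeY` — then this is T3's endpoint verbatim); `hrest` with `Θ′` (families 2–4 of `R`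
+ the defect family `Σ_□ conj b E_□`); `hV′` with `θ′_V` (transposed families 2–4 + `Σ_□ conj b E♯_□`); `hinvU : IsUnit Δ_a(U₁)`; bi-contractivity `hU`∕`hT`; the
plaquette datum `hW`; `η = |c_f|⁻¹`; `0 ≤ b₁`; [4] Lemma 2.1 (`h261`, `h263`); the smallness conditions `(Θ₁ + Θ′)c₁(α) < 1` and `(θ₁ + θ′_V)c₁(α) < 1` with
`θ₁ = N′·M₂(Σ‖b_j‖)·θ_Tᴮ·L⁵` («M sufficiently large»).  Output: `EBlock (kernelFamilyBInv i B cfg (GAY i parS parB Gp) par) (M₂(Σ‖b_j‖)·Bc) ((1−2α)δ₀) U₁`, `Bc` term by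
term as T3.  The defect families are an (R)-DESIGN TERM, NOT IN PRINT (bond twin of cell GAPS G-B9-p21-01).
DEFECT LABEL: the defect family `Σ_□E_□` (resp. `Σ_□E♯_□`) is an (R)-design term, NOT in print; `= 0` for print's `G_□ = (Δ_{loc,□} − DP_□D*)⁻¹` on the cube sequence (p. 409 l. 3–5) and for r05's `GACubeY` letters. [cite: Balaban1985BackgroundPropagators, Thm 3.3 p.399 (3.42) p.397 via Thm 3.10 pp.414–416, (3.105) p.414, p.414 l.33–35, p.415 l.6, (3.87) p.409, p.409 l.3–5, p.410 l.2–3; Balaban1984PropagatorsII, Prop. 2.2 (2.65)–(2.67) p.234, Lemma 2.1 (2.61) p.234] -/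
theorem eBlock_kernelFamilyBInv_GAY_of_localInverseCubes' (hι : ∀ s, β i.hN i.D i.hk (ιB s) = s)
    {M₂ : ℝ} (hM₂ : 0 ≤ M₂) (hrepr : ∀ (v : 𝔸) (j : ι), |b.repr v j| ≤ M₂ * ‖v‖) (hη : etaS i = |i.cf|⁻¹) (hb₁ : 0 ≤ b₁)
    (parS : SiteParY 𝔸 i) (parB : BondParY 𝔸 i) (Gp : SiteOpY 𝔸 i)
    (ζ : ↥(cubes i.D.toDomains) → SiteY i → ℝ) (hζ : ∀ c z, hTY i c z ≠ 0 → ζ c z = 1)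
    (Oc : ↥(cubes i.D.toDomains) → BondOpY 𝔸 i) (Pl P1l E Et : ↥(cubes i.D.toDomains) → Module.End ℂ (FBondY i → 𝔸))
    (hP1 : ∀ c, Pl c * cutMulY (hBdY i (hTY i c)) = cutMulY (hBdY i (hTY i c)) * Pl c + P1l c)
    (hdef : ∀ c, cutMulY (hBdY i (hTY i c)) * (deltaLocY i parB (cfg U₁) - Pl c) * Oc c (cfg U₁) * cutMulY (hBdY i (hTY i c)) =
      cutMulY (hBdY i (hTY i c)) * cutMulY (hBdY i (hTY i c)) - E c)
    (hdefT : ∀ c, cutMulY (hBdY i (hTY i c)) * Oc c (cfg U₁) * (deltaLocY i parB (cfg U₁) - Pl c) * cutMulY (hBdY i (hTY i c)) =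
      cutMulY (hBdY i (hTY i c)) * cutMulY (hBdY i (hTY i c)) - Et c)
    (hinvU : IsUnit (deltaAY i parS parB Gp (cfg U₁)))
    (D Ds : Fin (d + 1) → Module.End ℝ (FBondY i → 𝔸)) (hD : ∀ ν Λ, D ν Λ = cdB i (cfg U₁) ν Λ) (hDs : ∀ ν Λ, Ds ν Λ = cdsB i (cfg U₁) ν Λ)
    (Lp : Module.End ℝ (FBondY i → 𝔸)) (hLp : ∀ Λ, Lp Λ = lapB i (cfg U₁) Λ)
    (d' : ℕ) {δ₀ α Θ' θV' B₀ δh : ℝ}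
    (hB₀ : 0 ≤ B₀) (hδ₀ : 0 ≤ δ₀) (hΘ' : 0 ≤ Θ') (hθV' : 0 ≤ θV') (hδh : 0 ≤ δh)
    (hαδ : 0 ≤ α * δ₀) (hαδ2 : 0 ≤ (1 - 2 * α) * δ₀)
    (h261 : Ineq261 d' (toB6 (geo9K i) Rr Hp) δ₀ α) (h263 : Ineq263 d' (toB6 (geo9K i) Rr Hp) δ₀ α)
    (hsmall : ((3 * 5 ^ (d + 1) * (Real.exp (α * δ₀ * (2 * (ℓ : ℝ) + 6)) * B6.c1 d' δ₀ α)) *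
        (M₂ * (∑ j, ‖b j‖) * theta389B d ℓ B₀ b₁ δ₀ 1 (2 * δh) (δh * (((ℓ : ℝ) + 1) ^ 2 + 1)) δh 0 * ((geo9K i).M)⁻¹) + Θ') * B6.c1 d' δ₀ α < 1)
    (hsmallV : ((3 * 5 ^ (d + 1) * (Real.exp (α * δ₀ * (2 * (ℓ : ℝ) + 6)) * B6.c1 d' δ₀ α)) *
          (M₂ * (∑ j, ‖b j‖) *
            ((B₀ * (((d : ℝ) + 1) * (Real.exp (α * δ₀ * 2) * B6.c1 d' δ₀ α) * Real.exp (δ₀ * 2)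
                * ((2 * ((d : ℝ) + 1) + 4) * (5 / 8 * C1F d ℓ / i.Mh) + (5 / 8) ^ 2 * (C2F d ℓ + 2 * C2X d ℓ) / (i.Mh : ℝ) ^ 2
                    + 8 * δh * ((ℓ : ℝ) + 1) ^ 5 * (5 / 8 * C1F d ℓ / i.Mh) + 64 * δh * ((ℓ : ℝ) + 1) ^ 7 * (5 / 8 * C1F d ℓ / i.Mh))
              + (Real.exp (α * δ₀ * (2 * (ℓ : ℝ) + 6)) * B6.c1 d' δ₀ α) * Real.exp (δ₀ * (2 * (ℓ : ℝ) + 6))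
                * (4 * b₁ * ((ℓ : ℝ) + 1) ^ 6 * (((ℓ : ℝ) + 1) ^ (d + 1)) ^ 5 * (sLipT d ℓ / (((ℓ : ℝ) + 1) * i.Mh) * (((ℓ : ℝ) + 1) + 3)))))
              * ((ℓ : ℝ) + 1) ^ 5)) + θV') * B6.c1 d' δ₀ α < 1)
    (hE : ∀ c : ↥(cubes i.D.toDomains), EBlock (kernelFamilyBInv i B cfg (Oc c) par) B₀ δ₀ U₁)
    (hU : ∀ μ x, ‖(cfg U₁ μ x : 𝔸)‖ ≤ 1 ∧ ‖(((cfg U₁ μ x)⁻¹ : 𝔸ˣ) : 𝔸)‖ ≤ 1)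
    (hT : ∀ (y : IBondY i) (f : FBondY i), ‖(qT i parB (cfg U₁) y f : 𝔸)‖ ≤ 1 ∧ ‖(((qT i parB (cfg U₁) y f)⁻¹ : 𝔸ˣ) : 𝔸)‖ ≤ 1)
    (hW : ∀ p : PlaqY i, ‖((holY i (cfg U₁) p : 𝔸ˣ) : 𝔸) - 1‖ ≤ δh * ((((ℓ : ℝ) + 1) ^ levY i (chartY i p.src))⁻¹) ^ 2)
    (hrest : HasMajorant (g := toB6 (geo9K i) Rr Hp) (fun p : FBondY i × ι => ιB (blkV1 i.hN i.D p.1))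
      (∑ c, conj b (((1 - cutMulY (hBdY i (ζ c))) * DPDsY i parS Gp (cfg U₁) *
            (cutMulY (hBdY i (hTY i c)) * Oc c (cfg U₁) * cutMulY (hBdY i (hTY i c)))).restrictScalars ℝ)
        + ∑ c, conj b ((cutMulY (hBdY i (ζ c)) * (DPDsY i parS Gp (cfg U₁) - Pl c) *
            (cutMulY (hBdY i (hTY i c)) * Oc c (cfg U₁) * cutMulY (hBdY i (hTY i c)))).restrictScalars ℝ)
        + ∑ c, conj b ((cutMulY (hBdY i (ζ c)) * P1l c * Oc c (cfg U₁) * cutMulY (hBdY i (hTY i c))).restrictScalars ℝ)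
        + ∑ c, conj b ((E c).restrictScalars ℝ))
      (fun a a' => Θ' * Real.exp (-(δ₀ * (geo9K i).dist a a'))))
    (hV' : HasMajorant (g := toB6 (geo9K i) Rr Hp) (fun p : FBondY i × ι => ιB (blkV1 i.hN i.D p.1))
      (-(∑ c, conj b ((cutMulY (hBdY i (hTY i c)) * Oc c (cfg U₁) * P1l c).restrictScalars ℝ))
        + ∑ c, conj b ((cutMulY (hBdY i (hTY i c)) * Oc c (cfg U₁) * cutMulY (hBdY i (hTY i c)) *
            (cutMulY (hBdY i (ζ c)) * (DPDsY i parS Gp (cfg U₁) - Pl c))).restrictScalars ℝ)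
        + ∑ c, conj b ((cutMulY (hBdY i (hTY i c)) * Oc c (cfg U₁) * cutMulY (hBdY i (hTY i c)) *
            ((1 - cutMulY (hBdY i (ζ c))) * DPDsY i parS Gp (cfg U₁))).restrictScalars ℝ)
        + ∑ c, conj b ((Et c).restrictScalars ℝ))
      (fun a a' => θV' * (geo9K i).len a * ((geo9K i).len a')⁻¹ * Real.exp (-(δ₀ * (geo9K i).dist a a')))) :
    EBlock (kernelFamilyBInv i B cfg (GAY i parS parB Gp) par)
      (M₂ * (∑ j, ‖b j‖) *
        ((3 * 5 ^ (d + 1)) * (M₂ * (∑ j, ‖b j‖) * B₀) * B6.c1 d' δ₀ α *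
            (1 - ((3 * 5 ^ (d + 1) * (Real.exp (α * δ₀ * (2 * (ℓ : ℝ) + 6)) * B6.c1 d' δ₀ α)) *
              (M₂ * (∑ j, ‖b j‖) * theta389B d ℓ B₀ b₁ δ₀ 1 (2 * δh) (δh * (((ℓ : ℝ) + 1) ^ 2 + 1)) δh 0 * ((geo9K i).M)⁻¹) + Θ') *
              B6.c1 d' δ₀ α)⁻¹ +
          ((3 * 5 ^ (d + 1) * (Real.exp (α * δ₀ * (2 * (ℓ : ℝ) + 6)) * B6.c1 d' δ₀ α)) *
              (M₂ * (∑ j, ‖b j‖) * (B₀ * (1 + 5 * C1F d ℓ * (((ℓ : ℝ) + 1) * Real.exp δ₀) / (8 * (i.Mh : ℝ)))))) * B6.c1 d' δ₀ α *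
            (1 - ((3 * 5 ^ (d + 1) * (Real.exp (α * δ₀ * (2 * (ℓ : ℝ) + 6)) * B6.c1 d' δ₀ α)) *
              (M₂ * (∑ j, ‖b j‖) * theta389B d ℓ B₀ b₁ δ₀ 1 (2 * δh) (δh * (((ℓ : ℝ) + 1) ^ 2 + 1)) δh 0 * ((geo9K i).M)⁻¹) + Θ') *
              B6.c1 d' δ₀ α)⁻¹ +
          ((3 * 5 ^ (d + 1) * (Real.exp (α * δ₀ * (2 * (ℓ : ℝ) + 6)) * B6.c1 d' δ₀ α)) *
              (M₂ * (∑ j, ‖b j‖) * (B₀ * (1 + Real.exp (α * δ₀) * B6.c1 d' δ₀ α * Real.exp δ₀ * (5 / 8 * C1F d ℓ / i.Mh))))) * B6.c1 d' δ₀ α *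
            (1 - ((3 * 5 ^ (d + 1) * (Real.exp (α * δ₀ * (2 * (ℓ : ℝ) + 6)) * B6.c1 d' δ₀ α)) *
                (M₂ * (∑ j, ‖b j‖) *
                  ((B₀ * (((d : ℝ) + 1) * (Real.exp (α * δ₀ * 2) * B6.c1 d' δ₀ α) * Real.exp (δ₀ * 2)
                      * ((2 * ((d : ℝ) + 1) + 4) * (5 / 8 * C1F d ℓ / i.Mh) + (5 / 8) ^ 2 * (C2F d ℓ + 2 * C2X d ℓ) / (i.Mh : ℝ) ^ 2
                          + 8 * δh * ((ℓ : ℝ) + 1) ^ 5 * (5 / 8 * C1F d ℓ / i.Mh) + 64 * δh * ((ℓ : ℝ) + 1) ^ 7 * (5 / 8 * C1F d ℓ / i.Mh))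
                    + (Real.exp (α * δ₀ * (2 * (ℓ : ℝ) + 6)) * B6.c1 d' δ₀ α) * Real.exp (δ₀ * (2 * (ℓ : ℝ) + 6))
                      * (4 * b₁ * ((ℓ : ℝ) + 1) ^ 6 * (((ℓ : ℝ) + 1) ^ (d + 1)) ^ 5 * (sLipT d ℓ / (((ℓ : ℝ) + 1) * i.Mh) * (((ℓ : ℝ) + 1) + 3)))))
                    * ((ℓ : ℝ) + 1) ^ 5)) + θV') * B6.c1 d' δ₀ α)⁻¹ +
          ((3 * 5 ^ (d + 1) * (Real.exp (α * δ₀ * (2 * (ℓ : ℝ) + 6)) * B6.c1 d' δ₀ α)) *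
              (M₂ * (∑ j, ‖b j‖) * (B₀ * (1 + ((d : ℝ) + 1) * (5 / 8 * C1F d ℓ / i.Mh * (Real.exp δ₀ + 1) + 25 / 64 * C2F d ℓ / i.Mh ^ 2))))) * B6.c1 d' δ₀ α *
            (1 - ((3 * 5 ^ (d + 1) * (Real.exp (α * δ₀ * (2 * (ℓ : ℝ) + 6)) * B6.c1 d' δ₀ α)) *
              (M₂ * (∑ j, ‖b j‖) * theta389B d ℓ B₀ b₁ δ₀ 1 (2 * δh) (δh * (((ℓ : ℝ) + 1) ^ 2 + 1)) δh 0 * ((geo9K i).M)⁻¹) + Θ') *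
              B6.c1 d' δ₀ α)⁻¹))
      ((1 - 2 * α) * δ₀) U₁ := by
  classical
  obtain ⟨_, hMh2, _, _⟩ := side_conditions i
  have hM : (0 : ℝ) < i.Mh := by exact_mod_cast (lt_of_lt_of_le (by norm_num) hMh2)
  have hC1 : 0 ≤ C1F d ℓ := C1F_nonneg d ℓ
  have hC2 : 0 ≤ C2F d ℓ := C2F_nonneg d ℓ
  have hC2X : 0 ≤ C2X d ℓ := (C2X_bounds d ℓ).2.2
  have hsL : 0 ≤ sLipT d ℓ := sLipT_nonneg d ℓ
  have hSb : 0 ≤ ∑ j, ‖b j‖ := Finset.sum_nonneg fun _ _ => norm_nonneg _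
  have hc1 : 0 ≤ B6.c1 d' δ₀ α := c1_nonneg d' δ₀ α
  -- the two neighbourhood counts of T2 from (2.61)
  have hm₂ : 0 ≤ Real.exp (α * δ₀ * 2) * B6.c1 d' δ₀ α := by positivity
  have hmQ : 0 ≤ Real.exp (α * δ₀ * (2 * (ℓ : ℝ) + 6)) * B6.c1 d' δ₀ α := by positivity
  have hnbr₂ : ∀ y' : IBondY i, ((((Finset.univ : Finset ((geo9K i).Site)).filter fun a => (geo9K i).dist a y' ≤ 2).card : ℕ) : ℝ) ≤
      Real.exp (α * δ₀ * 2) * B6.c1 d' δ₀ α := fun y' => card_ball_le_of_ineq261 i d' hαδ h261 2 y'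
  have hnbrQ : ∀ y' : IBondY i, ((((Finset.univ : Finset ((geo9K i).Site)).filter fun a => (geo9K i).dist a y' ≤ 2 * (ℓ : ℝ) + 6).card : ℕ) : ℝ) ≤
      Real.exp (α * δ₀ * (2 * (ℓ : ℝ) + 6)) * B6.c1 d' δ₀ α := fun y' => card_ball_le_of_ineq261 i d' hαδ h261 _ y'
  -- the first family of the transposed remainder (§2)
  set θ₁ : ℝ := (3 * 5 ^ (d + 1) * (Real.exp (α * δ₀ * (2 * (ℓ : ℝ) + 6)) * B6.c1 d' δ₀ α)) *
      (M₂ * (∑ j, ‖b j‖) *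
        ((B₀ * (((d : ℝ) + 1) * (Real.exp (α * δ₀ * 2) * B6.c1 d' δ₀ α) * Real.exp (δ₀ * 2)
            * ((2 * ((d : ℝ) + 1) + 4) * (5 / 8 * C1F d ℓ / i.Mh) + (5 / 8) ^ 2 * (C2F d ℓ + 2 * C2X d ℓ) / (i.Mh : ℝ) ^ 2
                + 8 * δh * ((ℓ : ℝ) + 1) ^ 5 * (5 / 8 * C1F d ℓ / i.Mh) + 64 * δh * ((ℓ : ℝ) + 1) ^ 7 * (5 / 8 * C1F d ℓ / i.Mh))
          + (Real.exp (α * δ₀ * (2 * (ℓ : ℝ) + 6)) * B6.c1 d' δ₀ α) * Real.exp (δ₀ * (2 * (ℓ : ℝ) + 6))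
            * (4 * b₁ * ((ℓ : ℝ) + 1) ^ 6 * (((ℓ : ℝ) + 1) ^ (d + 1)) ^ 5 * (sLipT d ℓ / (((ℓ : ℝ) + 1) * i.Mh) * (((ℓ : ℝ) + 1) + 3)))))
          * ((ℓ : ℝ) + 1) ^ 5)) with hθ₁
  have hθ₁0 : 0 ≤ θ₁ := by positivity
  have h1 := hasMajorant_sum_conj_transposedCommB_Oc i b ιB cfg par (Rr := Rr) (Hp := Hp) hι hM₂ hrepr hη Oc parB hB₀ hδ₀ hE hU hT hδh hW
    (fun y' : IBondY i => ((Finset.univ : Finset ((geo9K i).Site)).filter fun a => (geo9K i).dist a y' ≤ 2))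
    (fun a y' h => Finset.mem_filter.2 ⟨Finset.mem_univ (α := (geo9K i).Site) a, h⟩) hm₂ hnbr₂
    (fun y' : IBondY i => ((Finset.univ : Finset ((geo9K i).Site)).filter fun a => (geo9K i).dist a y' ≤ 2 * (ℓ : ℝ) + 6))
    (fun a y' h => Finset.mem_filter.2 ⟨Finset.mem_univ (α := (geo9K i).Site) a, h⟩) hmQ hnbrQ d' hαδ h261
  -- the four families together: `θ_V = θ₁ + θ′_V`
  have hV : HasMajorant (g := toB6 (geo9K i) Rr Hp) (fun p : FBondY i × ι => ιB (blkV1 i.hN i.D p.1))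
      (-(∑ c, conj b ((cutMulY (hBdY i (hTY i c)) * Oc c (cfg U₁) * KhBY i (hTY i c) parB (cfg U₁)).restrictScalars ℝ))
        - ∑ c, conj b ((cutMulY (hBdY i (hTY i c)) * Oc c (cfg U₁) * P1l c).restrictScalars ℝ)
        + ∑ c, conj b ((cutMulY (hBdY i (hTY i c)) * Oc c (cfg U₁) * cutMulY (hBdY i (hTY i c)) *
            (cutMulY (hBdY i (ζ c)) * (DPDsY i parS Gp (cfg U₁) - Pl c))).restrictScalars ℝ)
        + ∑ c, conj b ((cutMulY (hBdY i (hTY i c)) * Oc c (cfg U₁) * cutMulY (hBdY i (hTY i c)) *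
            ((1 - cutMulY (hBdY i (ζ c))) * DPDsY i parS Gp (cfg U₁))).restrictScalars ℝ)
        + ∑ c, conj b ((Et c).restrictScalars ℝ))
      (fun a a' => (θ₁ + θV') * (geo9K i).len a * ((geo9K i).len a')⁻¹ * Real.exp (-(δ₀ * (geo9K i).dist a a'))) := by
    have e : (-(∑ c, conj b ((cutMulY (hBdY i (hTY i c)) * Oc c (cfg U₁) * KhBY i (hTY i c) parB (cfg U₁)).restrictScalars ℝ))
        - ∑ c, conj b ((cutMulY (hBdY i (hTY i c)) * Oc c (cfg U₁) * P1l c).restrictScalars ℝ)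
        + ∑ c, conj b ((cutMulY (hBdY i (hTY i c)) * Oc c (cfg U₁) * cutMulY (hBdY i (hTY i c)) *
            (cutMulY (hBdY i (ζ c)) * (DPDsY i parS Gp (cfg U₁) - Pl c))).restrictScalars ℝ)
        + ∑ c, conj b ((cutMulY (hBdY i (hTY i c)) * Oc c (cfg U₁) * cutMulY (hBdY i (hTY i c)) *
            ((1 - cutMulY (hBdY i (ζ c))) * DPDsY i parS Gp (cfg U₁))).restrictScalars ℝ)
        + ∑ c, conj b ((Et c).restrictScalars ℝ))
        = (-(∑ c, conj b ((cutMulY (hBdY i (hTY i c)) * Oc c (cfg U₁) * KhBY i (hTY i c) parB (cfg U₁)).restrictScalars ℝ)))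
          + ((-(∑ c, conj b ((cutMulY (hBdY i (hTY i c)) * Oc c (cfg U₁) * P1l c).restrictScalars ℝ)))
            + ∑ c, conj b ((cutMulY (hBdY i (hTY i c)) * Oc c (cfg U₁) * cutMulY (hBdY i (hTY i c)) *
                (cutMulY (hBdY i (ζ c)) * (DPDsY i parS Gp (cfg U₁) - Pl c))).restrictScalars ℝ)
            + ∑ c, conj b ((cutMulY (hBdY i (hTY i c)) * Oc c (cfg U₁) * cutMulY (hBdY i (hTY i c)) *
                ((1 - cutMulY (hBdY i (ζ c))) * DPDsY i parS Gp (cfg U₁))).restrictScalars ℝ)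
            + ∑ c, conj b ((Et c).restrictScalars ℝ)) := by
      abel
    rw [e]
    refine hasMajorant_mono (g := toB6 (geo9K i) Rr Hp) _ (hasMajorant_add _ (hasMajorant_neg' _ h1) hV') fun a a' => le_of_eq ?_
    rw [hθ₁]; ring
  have hθV : 0 ≤ θ₁ + θV' := add_nonneg hθ₁0 hθV'
  have hsmallV' : (θ₁ + θV') * B6.c1 d' δ₀ α < 1 := by rw [hθ₁]; exact hsmallV
  exact eBlock_kernelFamilyBInv_GAY_of_localInverseCubes i b ιB cfg par hι hM₂ hrepr hη hb₁ parS parB Gp ζ hζ Oc Pl P1l E Et hP1 hdef hdefT hinvU D Ds hD hDs Lp hLp d'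
    hB₀ hδ₀ hΘ' hθV hδh hαδ hαδ2 h261 h263 hsmall hsmallV' hE hU hT hW hrest hV

end Endpoint

/-! ## §5 The exact-law form of the endpoint -/

section Exact

/-- ★★★ **THE EXACT-LAW FORM OF THE ENDPOINT** (`E = E♯ = 0`): for cube letters satisfying the two local-inverse laws EXACTLY (`hloc`∕`hlocT`, the shapes of
`B9Eq3105AtLetters.eq3105_deltaAY` ∕ `B9Eq3105TAtLetters.eq3105T_deltaAY`; print's letters, r05's `GACubeY`) the defect families drop out of `hrest` ∕ `hV′` (three printed
families each) — the bond twin of p21's `eBlock_kernelFamilySInv_Gp_of_localInverse` in its literal shape.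
[cite: Balaban1985BackgroundPropagators, Thm 3.3 p.399 (3.42) p.397 via Thm 3.10 pp.414–416, (3.105) p.414, (3.87) p.409, p.409 l.3–5; Balaban1984PropagatorsII, Prop. 2.2 (2.65)–(2.67) p.234] -/
theorem eBlock_kernelFamilyBInv_GAY_of_localInverseCubes'_exact (hι : ∀ s, β i.hN i.D i.hk (ιB s) = s)
    {M₂ : ℝ} (hM₂ : 0 ≤ M₂) (hrepr : ∀ (v : 𝔸) (j : ι), |b.repr v j| ≤ M₂ * ‖v‖) (hη : etaS i = |i.cf|⁻¹) (hb₁ : 0 ≤ b₁)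
    (parS : SiteParY 𝔸 i) (parB : BondParY 𝔸 i) (Gp : SiteOpY 𝔸 i)
    (ζ : ↥(cubes i.D.toDomains) → SiteY i → ℝ) (hζ : ∀ c z, hTY i c z ≠ 0 → ζ c z = 1)
    (Oc : ↥(cubes i.D.toDomains) → BondOpY 𝔸 i) (Pl P1l : ↥(cubes i.D.toDomains) → Module.End ℂ (FBondY i → 𝔸))
    (hP1 : ∀ c, Pl c * cutMulY (hBdY i (hTY i c)) = cutMulY (hBdY i (hTY i c)) * Pl c + P1l c)
    (hloc : ∀ c, cutMulY (hBdY i (hTY i c)) * (deltaLocY i parB (cfg U₁) - Pl c) * Oc c (cfg U₁) * cutMulY (hBdY i (hTY i c)) =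
      cutMulY (hBdY i (hTY i c)) * cutMulY (hBdY i (hTY i c)))
    (hlocT : ∀ c, cutMulY (hBdY i (hTY i c)) * Oc c (cfg U₁) * (deltaLocY i parB (cfg U₁) - Pl c) * cutMulY (hBdY i (hTY i c)) =
      cutMulY (hBdY i (hTY i c)) * cutMulY (hBdY i (hTY i c)))
    (hinvU : IsUnit (deltaAY i parS parB Gp (cfg U₁)))
    (D Ds : Fin (d + 1) → Module.End ℝ (FBondY i → 𝔸)) (hD : ∀ ν Λ, D ν Λ = cdB i (cfg U₁) ν Λ) (hDs : ∀ ν Λ, Ds ν Λ = cdsB i (cfg U₁) ν Λ)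
    (Lp : Module.End ℝ (FBondY i → 𝔸)) (hLp : ∀ Λ, Lp Λ = lapB i (cfg U₁) Λ)
    (d' : ℕ) {δ₀ α Θ' θV' B₀ δh : ℝ}
    (hB₀ : 0 ≤ B₀) (hδ₀ : 0 ≤ δ₀) (hΘ' : 0 ≤ Θ') (hθV' : 0 ≤ θV') (hδh : 0 ≤ δh)
    (hαδ : 0 ≤ α * δ₀) (hαδ2 : 0 ≤ (1 - 2 * α) * δ₀)
    (h261 : Ineq261 d' (toB6 (geo9K i) Rr Hp) δ₀ α) (h263 : Ineq263 d' (toB6 (geo9K i) Rr Hp) δ₀ α)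
    (hsmall : ((3 * 5 ^ (d + 1) * (Real.exp (α * δ₀ * (2 * (ℓ : ℝ) + 6)) * B6.c1 d' δ₀ α)) *
        (M₂ * (∑ j, ‖b j‖) * theta389B d ℓ B₀ b₁ δ₀ 1 (2 * δh) (δh * (((ℓ : ℝ) + 1) ^ 2 + 1)) δh 0 * ((geo9K i).M)⁻¹) + Θ') * B6.c1 d' δ₀ α < 1)
    (hsmallV : ((3 * 5 ^ (d + 1) * (Real.exp (α * δ₀ * (2 * (ℓ : ℝ) + 6)) * B6.c1 d' δ₀ α)) *
          (M₂ * (∑ j, ‖b j‖) *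
            ((B₀ * (((d : ℝ) + 1) * (Real.exp (α * δ₀ * 2) * B6.c1 d' δ₀ α) * Real.exp (δ₀ * 2)
                * ((2 * ((d : ℝ) + 1) + 4) * (5 / 8 * C1F d ℓ / i.Mh) + (5 / 8) ^ 2 * (C2F d ℓ + 2 * C2X d ℓ) / (i.Mh : ℝ) ^ 2
                    + 8 * δh * ((ℓ : ℝ) + 1) ^ 5 * (5 / 8 * C1F d ℓ / i.Mh) + 64 * δh * ((ℓ : ℝ) + 1) ^ 7 * (5 / 8 * C1F d ℓ / i.Mh))
              + (Real.exp (α * δ₀ * (2 * (ℓ : ℝ) + 6)) * B6.c1 d' δ₀ α) * Real.exp (δ₀ * (2 * (ℓ : ℝ) + 6))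
                * (4 * b₁ * ((ℓ : ℝ) + 1) ^ 6 * (((ℓ : ℝ) + 1) ^ (d + 1)) ^ 5 * (sLipT d ℓ / (((ℓ : ℝ) + 1) * i.Mh) * (((ℓ : ℝ) + 1) + 3)))))
              * ((ℓ : ℝ) + 1) ^ 5)) + θV') * B6.c1 d' δ₀ α < 1)
    (hE : ∀ c : ↥(cubes i.D.toDomains), EBlock (kernelFamilyBInv i B cfg (Oc c) par) B₀ δ₀ U₁)
    (hU : ∀ μ x, ‖(cfg U₁ μ x : 𝔸)‖ ≤ 1 ∧ ‖(((cfg U₁ μ x)⁻¹ : 𝔸ˣ) : 𝔸)‖ ≤ 1)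
    (hT : ∀ (y : IBondY i) (f : FBondY i), ‖(qT i parB (cfg U₁) y f : 𝔸)‖ ≤ 1 ∧ ‖(((qT i parB (cfg U₁) y f)⁻¹ : 𝔸ˣ) : 𝔸)‖ ≤ 1)
    (hW : ∀ p : PlaqY i, ‖((holY i (cfg U₁) p : 𝔸ˣ) : 𝔸) - 1‖ ≤ δh * ((((ℓ : ℝ) + 1) ^ levY i (chartY i p.src))⁻¹) ^ 2)
    (hrest : HasMajorant (g := toB6 (geo9K i) Rr Hp) (fun p : FBondY i × ι => ιB (blkV1 i.hN i.D p.1))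
      (∑ c, conj b (((1 - cutMulY (hBdY i (ζ c))) * DPDsY i parS Gp (cfg U₁) *
            (cutMulY (hBdY i (hTY i c)) * Oc c (cfg U₁) * cutMulY (hBdY i (hTY i c)))).restrictScalars ℝ)
        + ∑ c, conj b ((cutMulY (hBdY i (ζ c)) * (DPDsY i parS Gp (cfg U₁) - Pl c) *
            (cutMulY (hBdY i (hTY i c)) * Oc c (cfg U₁) * cutMulY (hBdY i (hTY i c)))).restrictScalars ℝ)
        + ∑ c, conj b ((cutMulY (hBdY i (ζ c)) * P1l c * Oc c (cfg U₁) * cutMulY (hBdY i (hTY i c))).restrictScalars ℝ))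
      (fun a a' => Θ' * Real.exp (-(δ₀ * (geo9K i).dist a a'))))
    (hV' : HasMajorant (g := toB6 (geo9K i) Rr Hp) (fun p : FBondY i × ι => ιB (blkV1 i.hN i.D p.1))
      (-(∑ c, conj b ((cutMulY (hBdY i (hTY i c)) * Oc c (cfg U₁) * P1l c).restrictScalars ℝ))
        + ∑ c, conj b ((cutMulY (hBdY i (hTY i c)) * Oc c (cfg U₁) * cutMulY (hBdY i (hTY i c)) *
            (cutMulY (hBdY i (ζ c)) * (DPDsY i parS Gp (cfg U₁) - Pl c))).restrictScalars ℝ)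
        + ∑ c, conj b ((cutMulY (hBdY i (hTY i c)) * Oc c (cfg U₁) * cutMulY (hBdY i (hTY i c)) *
            ((1 - cutMulY (hBdY i (ζ c))) * DPDsY i parS Gp (cfg U₁))).restrictScalars ℝ))
      (fun a a' => θV' * (geo9K i).len a * ((geo9K i).len a')⁻¹ * Real.exp (-(δ₀ * (geo9K i).dist a a')))) :
    EBlock (kernelFamilyBInv i B cfg (GAY i parS parB Gp) par)
      (M₂ * (∑ j, ‖b j‖) *
        ((3 * 5 ^ (d + 1)) * (M₂ * (∑ j, ‖b j‖) * B₀) * B6.c1 d' δ₀ α *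
            (1 - ((3 * 5 ^ (d + 1) * (Real.exp (α * δ₀ * (2 * (ℓ : ℝ) + 6)) * B6.c1 d' δ₀ α)) *
              (M₂ * (∑ j, ‖b j‖) * theta389B d ℓ B₀ b₁ δ₀ 1 (2 * δh) (δh * (((ℓ : ℝ) + 1) ^ 2 + 1)) δh 0 * ((geo9K i).M)⁻¹) + Θ') *
              B6.c1 d' δ₀ α)⁻¹ +
          ((3 * 5 ^ (d + 1) * (Real.exp (α * δ₀ * (2 * (ℓ : ℝ) + 6)) * B6.c1 d' δ₀ α)) *
              (M₂ * (∑ j, ‖b j‖) * (B₀ * (1 + 5 * C1F d ℓ * (((ℓ : ℝ) + 1) * Real.exp δ₀) / (8 * (i.Mh : ℝ)))))) * B6.c1 d' δ₀ α *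
            (1 - ((3 * 5 ^ (d + 1) * (Real.exp (α * δ₀ * (2 * (ℓ : ℝ) + 6)) * B6.c1 d' δ₀ α)) *
              (M₂ * (∑ j, ‖b j‖) * theta389B d ℓ B₀ b₁ δ₀ 1 (2 * δh) (δh * (((ℓ : ℝ) + 1) ^ 2 + 1)) δh 0 * ((geo9K i).M)⁻¹) + Θ') *
              B6.c1 d' δ₀ α)⁻¹ +
          ((3 * 5 ^ (d + 1) * (Real.exp (α * δ₀ * (2 * (ℓ : ℝ) + 6)) * B6.c1 d' δ₀ α)) *
              (M₂ * (∑ j, ‖b j‖) * (B₀ * (1 + Real.exp (α * δ₀) * B6.c1 d' δ₀ α * Real.exp δ₀ * (5 / 8 * C1F d ℓ / i.Mh))))) * B6.c1 d' δ₀ α *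
            (1 - ((3 * 5 ^ (d + 1) * (Real.exp (α * δ₀ * (2 * (ℓ : ℝ) + 6)) * B6.c1 d' δ₀ α)) *
                (M₂ * (∑ j, ‖b j‖) *
                  ((B₀ * (((d : ℝ) + 1) * (Real.exp (α * δ₀ * 2) * B6.c1 d' δ₀ α) * Real.exp (δ₀ * 2)
                      * ((2 * ((d : ℝ) + 1) + 4) * (5 / 8 * C1F d ℓ / i.Mh) + (5 / 8) ^ 2 * (C2F d ℓ + 2 * C2X d ℓ) / (i.Mh : ℝ) ^ 2
                          + 8 * δh * ((ℓ : ℝ) + 1) ^ 5 * (5 / 8 * C1F d ℓ / i.Mh) + 64 * δh * ((ℓ : ℝ) + 1) ^ 7 * (5 / 8 * C1F d ℓ / i.Mh))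
                    + (Real.exp (α * δ₀ * (2 * (ℓ : ℝ) + 6)) * B6.c1 d' δ₀ α) * Real.exp (δ₀ * (2 * (ℓ : ℝ) + 6))
                      * (4 * b₁ * ((ℓ : ℝ) + 1) ^ 6 * (((ℓ : ℝ) + 1) ^ (d + 1)) ^ 5 * (sLipT d ℓ / (((ℓ : ℝ) + 1) * i.Mh) * (((ℓ : ℝ) + 1) + 3)))))
                    * ((ℓ : ℝ) + 1) ^ 5)) + θV') * B6.c1 d' δ₀ α)⁻¹ +
          ((3 * 5 ^ (d + 1) * (Real.exp (α * δ₀ * (2 * (ℓ : ℝ) + 6)) * B6.c1 d' δ₀ α)) *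
              (M₂ * (∑ j, ‖b j‖) * (B₀ * (1 + ((d : ℝ) + 1) * (5 / 8 * C1F d ℓ / i.Mh * (Real.exp δ₀ + 1) + 25 / 64 * C2F d ℓ / i.Mh ^ 2))))) * B6.c1 d' δ₀ α *
            (1 - ((3 * 5 ^ (d + 1) * (Real.exp (α * δ₀ * (2 * (ℓ : ℝ) + 6)) * B6.c1 d' δ₀ α)) *
              (M₂ * (∑ j, ‖b j‖) * theta389B d ℓ B₀ b₁ δ₀ 1 (2 * δh) (δh * (((ℓ : ℝ) + 1) ^ 2 + 1)) δh 0 * ((geo9K i).M)⁻¹) + Θ') *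
              B6.c1 d' δ₀ α)⁻¹))
      ((1 - 2 * α) * δ₀) U₁ := by
  have h0 : (∑ c : ↥(cubes i.D.toDomains), conj b (((fun _ : ↥(cubes i.D.toDomains) => (0 : Module.End ℂ (FBondY i → 𝔸))) c).restrictScalars ℝ)) = 0 := by
    simp only [LinearMap.restrictScalars_zero, B9Eq352DivFormLetters.conj, map_zero, Finset.sum_const_zero]
  refine eBlock_kernelFamilyBInv_GAY_of_localInverseCubes' i b ιB cfg par hι hM₂ hrepr hη hb₁ parS parB Gp ζ hζ Oc Pl P1l
    (fun _ => 0) (fun _ => 0) hP1 (fun c => by rw [hloc c, sub_zero]) (fun c => by rw [hlocT c, sub_zero]) hinvU D Ds hD hDs Lp hLp d'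
    hB₀ hδ₀ hΘ' hθV' hδh hαδ hαδ2 h261 h263 hsmall hsmallV hE hU hT hW ?_ ?_
  · rw [h0, add_zero]; exact hrest
  · rw [h0, add_zero]; exact hV'

end Exact

end Literature.MathematicalPhysics.QuantumFieldTheory.Balaban1983to89.B9Thm310GOfLocalInverseCubes

end
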